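import Literature.LinearAlgebra.Matrix.GL3ZIntegerEigenvaluesTriangular
import HarnessLib

/-!
# Integer `3 × 3` matrices with three DIFFERENT integer eigenvalues: the EXACT normal form under
# `GL₃(ℤ)`-conjugation (Hertling–Larabi 2026b, Lemma 9.6 (a) with Remarks 9.7 (iii)) — uniqueness proved, with a
# correction of the printed domain (9.17)

[topic LinearAlgebra/Matrix] Sequel to `GL3ZIntegerEigenvaluesTriangular` (p19 g40-#2: `exists_conj_upperTriangular`,
the moves `triangular_shear₁₂/₂₃/₁₃_conj`, `triangular_diag_conj`, `charpoly_triangular`, and the SEMI-normal form —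
all REUSED; its docstring lists «NOT here: the exact normal form (9.17) / Lemma 9.6 and the exact class numbers (e.g.
the ten classes for `(λ₁, λ₂, λ₃) = (2, 0, −2)` of §9.4)», which is what this file supplies).  Lane `lit-hodgefound`
(Track 2 foundations library), seat p19 generation 41, rows g41-#6 (§0–§7) and g41-#8 (§8).  THEOREMS ONLY: no definition, no instance, no
notation, no named fact (D-0026, net Literature debt `0`), no `sorry`.

## Source, VERBATIM

C. Hertling, K. Larabi, *Conjugacy classes of regular integer matrices*, arXiv:2602.15748 (2026)
[HertlingLarabi2026b], held `paper:arxiv-2602.15748`, §9 «The separable cases with 1-dimensional summands»,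
`A = ℚe₁ + ℚe₂ + ℚe₃`, `eᵢeⱼ = δᵢⱼeᵢ`.
* §9.3, chunk p0030, before Lemma 9.6: «Next we find normal forms and the orders for all `ε`-classes of full lattices
  in `A`. The conditions in (9.17) for a normal form in (9.16) are much more involved than the conditions
  `δ₂, δ₃ ∈ [0, 1/2]`, `δ₁ ∈ [0; 1]` for a semi-normal form in (9.16).»
* **Lemma 9.6 (a)** (chunk p0030): «Each `ε`-class of full lattices in `A` contains a unique full lattice with a
  `ℤ`-basis `e·(1 δ₁ δ₃; 0 1 δ₂; 0 0 1)` with `δ₁, δ₂, δ₃ ∈ ℚ` (9.16) and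
  `δ₂, δ₃ ∈ [0, ½]`,
  `δ₁ ∈ [0, 1]` if `(δ₂, δ₃) ∈ (0, ½) × (0, ½)`,
  `δ₁ ∈ [0, ½]` if `(δ₂, δ₃) ∈ (0, ½) × {0, ½} ∪ {0} × (0, ½) ∪ {(0, 0), (0, ½), (½, 0)}`,
  `δ₁ ∈ [0, 2δ₃]` if `(δ₂, δ₃) ∈ {½} × (0, ½)`,
  `δ₁ ∈ [0, ½)` if `(δ₂, δ₃) = (½, ½)` (9.17).
  The `ℤ`-basis is unique.»  Proof (chunk p0030): «From (9.2) it is clear that each `ε`-class contains a full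
  lattice `L` with a `ℤ`-basis as in (9.16) with `δ₂, δ₃ ∈ [0, 1/2]` and `δ₁ ∈ [0, 1]`. It is also clear that in the
  interior cases `(δ₂, δ₃) ∈ (0, 1/2) × (0, 1/2)` this is unique and is a normal form. But in the boundary cases […]
  also a full lattice `u·L` with a suitable unit `u ∈ {±e₁ ± e₂ ± e₃}` has such a `ℤ`-basis, with other coefficients.
  The case `(δ₂, δ₃) ∈ [0, 1/2] × {0}`: […] The full lattice `(−e₁+e₂+e₃)L` has the `ℤ`-basis
  `e(1 1−δ₁ 0; 0 1 δ₂; 0 0 1)`. The case `(δ₂, δ₃) ∈ {0} × (0, 1/2]`: […] `(e₁−e₂+e₃)L` has the `ℤ`-basis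
  `e(1 1−δ₁ δ₃; 0 1 0; 0 0 1)`. The case `(δ₂, δ₃) ∈ (0, 1/2] × {1/2}`: […] `(−e₁+e₂+e₃)L` has the `ℤ`-basis
  `e(1 1−δ₁ 1/2; 0 1 δ₂; 0 0 1)`. In the special case `(δ₁, δ₂, δ₃) = (1/2, 1/2, 1/2)` we replace `1/2e₁+1/2e₂+e₃` by
  `(1/2−1/2)e₁ + (1/2−1)e₂ + e₃` and `1/2e₁+e₂` by `(1/2−1)e₁+e₂`.»
* **Remarks 9.7 (iii)** (chunk p0031): «Consider three different integers `λ₁, λ₂` and `λ₃` and the cyclic order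
  `Λ = ℤ[λ₁e₁ + λ₂e₂ + λ₃e₃]`. An `ε`-class `[L]_ε` of a full lattice `L` with `𝒪(L) ⊃ Λ` determines a conjugacy class
  of integer `3×3` matrices with eigenvalues `λ₁, λ₂` and `λ₃`. Lemma 9.6 (a) offers a unique matrix `M` in the
  conjugacy class via `(λ₁e₁ + λ₂e₂ + λ₃e₃)·eD = eD·M` where `eD` is the `ℤ`-basis in (9.16) with (9.17) for the full
  lattice in Lemma 9.6 (a) in the `ε`-class `[L]_ε`.»
* §9.4, chunk p0032: «One finds ten lattices […] The ten matrices `M` in column 4 and the ten matrices `M` in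
  column 5 are different representatives of the ten conjugacy classes of integer `3×3` matrices with eigenvalues
  `2, 0, −2`.»

## The dictionary (matrix side) and the normal form

For `D = (1 δ₁ δ₃; 0 1 δ₂; 0 0 1)` one computes `M = D⁻¹·diag(λ₁, λ₂, λ₃)·D = (λ₁ a b; 0 λ₂ c; 0 0 λ₃)` with
`a = δ₁(λ₁−λ₂)`, `c = δ₂(λ₂−λ₃)`, `b = δ₃(λ₁−λ₃) − δ₁δ₂(λ₂−λ₃)`, i.e. with `B := b(λ₁−λ₂) + ac`:
`δ₁ = a/(λ₁−λ₂)`, `δ₂ = c/(λ₂−λ₃)`, `δ₃ = B/((λ₁−λ₂)(λ₁−λ₃))`; two `ℤ`-bases of lattices in one `ε`-class give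
`GL₃(ℤ)`-conjugate matrices and conversely (Theorem 6.3).  We fix the labelling `λ₁ > λ₂ > λ₃` (any three different
integers can be so labelled; the hypothesis is `χ_N = (t−λ₁)(t−λ₂)(t−λ₃)`), so that `λ₁−λ₂, λ₂−λ₃, λ₁−λ₃ > 0`.  The
NORMAL FORM proved here is: `(λ₁ a b; 0 λ₂ c; 0 0 λ₃)` with
* (N1) `0 ≤ 2c ≤ λ₂−λ₃` (`δ₂ ∈ [0, ½]`),  (N2) `0 ≤ 2B ≤ (λ₁−λ₂)(λ₁−λ₃)` (`δ₃ ∈ [0, ½]`),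
  (N3) `0 ≤ a < λ₁−λ₂` (`δ₁ ∈ [0, 1)`),
* (N4) `c = 0 ∨ B = 0 ∨ 2B = (λ₁−λ₂)(λ₁−λ₃) ⟹ 2a ≤ λ₁−λ₂` (`δ₂ = 0` or `δ₃ ∈ {0, ½}` ⟹ `δ₁ ≤ ½`),
* (N5) `2c = λ₂−λ₃ ∧ B = 0 ⟹ a = 0 ∨ 2a = λ₁−λ₂` (`(δ₂, δ₃) = (½, 0)` ⟹ `δ₁ ∈ {0, ½}`),
* (N6) `2c = λ₂−λ₃ ∧ 2B = (λ₁−λ₂)(λ₁−λ₃) ⟹ 2a < λ₁−λ₂` (`(δ₂, δ₃) = (½, ½)` ⟹ `δ₁ < ½`),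
* (N7) `2c = λ₂−λ₃ ∧ 0 < 2B < (λ₁−λ₂)(λ₁−λ₃) ⟹ a(λ₁−λ₃) ≤ 2B` (`δ₂ = ½`, `δ₃ ∈ (0, ½)` ⟹ `δ₁ ≤ 2δ₃`).
`normalForm_iff_cases` proves that (N1)–(N7) is LITERALLY the case list (9.17) in these coordinates, except for two
points — **the correction**: (i) in the interior case the printed `δ₁ ∈ [0, 1]` must be read `δ₁ ∈ [0, 1)` (`δ₁ = 1`
and `δ₁ = 0` give the same lattice by (9.1)/(9.2); evidently intended, `printed_normalForm_not_unique'`); (ii) in the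
sub-case `(δ₂, δ₃) = (½, 0)` the printed range `δ₁ ∈ [0, ½]` is too large: for `δ₁ ∈ (0, ½)` the lattice with
coordinates `(δ₁, ½, 0)` is `ε`-equivalent (by the unit `e₁ + e₂ − e₃` followed by `δ₂ ↦ δ₂ + 1`, our move `ρ`:
`(δ₁, ½, δ₃) ↦ (δ₁, ½, δ₁ − δ₃)`) to the one with `(δ₁, ½, δ₁)`, which is ALSO in the printed list (clause
`{½} × (0, ½)`, `δ₁ ≤ 2δ₃`); so Lemma 9.6 (a) as printed lists two bases in one `ε`-class and its uniqueness statement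
fails there — `printed_normalForm_not_unique` gives the explicit pair `(9 1 −1; 0 6 3; 0 0 0) ∼ (9 1 2; 0 6 3; 0 0 0)`
for `(λ₁, λ₂, λ₃) = (9, 6, 0)`.  With (N5) in place of that clause the list IS an exact normal form: existence
`exists_conj_normalForm` and uniqueness `normalForm_unique` are proved below for all `λ₁ > λ₂ > λ₃`, and the count for
`(2, 0, −2)` comes out as HL's ten (§6; there the faulty sub-case is empty).  (Brute force over all
`1 ≤ λ₁−λ₂, λ₂−λ₃ ≤ 6` confirmed the corrected list class by class before formalisation; e.g. for
`(λ₁−λ₂, λ₂−λ₃) = (3, 6)` the printed list has more members than there are classes.)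

## What is proved (no `sorry`, no new definitions)

* §1 conjugators between two triangular forms with the same distinct diagonal are upper triangular with unit diagonal
  (`upper_of_conj`, `diag_mul_self_eq_one_of_conj`), and the transformation law of `B = b(λ₁−λ₂) + ac`
  (`bInv_eq_of_conj`: `B′ = ε₁ε₃B − ε₃P₁₂·a′(λ₁−λ₃) − ε₃P₀₂·(λ₁−λ₂)(λ₁−λ₃)`).
* §2 the moves on `(a, b, c)` / `(a, c, B)`: `move₁₂₃`, `sign₁₂₃` (from the tree), the composites `rho_conj` (`ρ`),
  `flip_conj` (`φ`: `δ₁ ↦ 1−δ₁`, `δ₃ ↦ 1−δ₃`), `flip₀_conj`, `flipc_conj`, with their effect on `B`.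
* §3 **existence** `exists_conj_normalForm_of_form`, `exists_conj_normalForm` (steps: `δ₂`, then `δ₃`, then `δ₁`,
  then the boundary repairs (N4), then the `δ₂ = ½` repairs (N5)–(N7) via `ρ` and `φ`).
* §4 **uniqueness** `normalForm_unique`: conjugate normal forms are equal (w.l.o.g. `ε₁ = 1`; four sign patterns
  `unique_case₁…₄`, the only nonlinear input being the monotonicity of `a ↦ a(λ₁−λ₃)`).
* §5 `existsUnique_conj_normalForm`; the bijection `exists_bijective_quot_conj` between the class set (a `Quot` by
  `PN = N′P`, `P` unimodular, cf. `LatimerMacDuffeeOrderStrata.equivalence_conj`; the forms lie in it by the tree's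
  `charpoly_triangular`) and the subtype of triples; `natCard_quot_conj_eq`; `normalForm_iff_cases` ((N1)–(N7) ⟺
  corrected (9.17)).
* §6 `normalForm_two_zero_negTwo_iff`, `natCard_normalForms_two_zero_negTwo`: the ten normal forms for `2, 0, −2`
  (with `natCard_quot_conj_eq`: the ten classes, agreeing with the tree's certificate count
  `GL3ZClassesTwoZeroMinusTwo.natCard_quot_conj_eq_ten`, which is not restated).
* §7 `printed_normalForm_not_unique`, `printed_normalForm_not_unique'`: the two corrections, with witnesses.
* §8 the `δ`-dictionary over `ℚ`: `diag_mul_basis_eq` (Remarks 9.7 (iii) computed: the matrix of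
  `λ₁e₁ + λ₂e₂ + λ₃e₃` in the basis `eD` of (9.16)), `bInv_basis_eq` (`B = δ₃(λ₁−λ₂)(λ₁−λ₃)`), and
  **`normalForm_iff_delta`**: (N1)–(N7) ⟺ the corrected (9.17) stated literally in `δ₁, δ₂, δ₃`.
NOT here: the lattice-side statements (b), (c) of Lemma 9.6 (orders `𝒪(L) = Λ_{α₁α₂α₃}`), Lemma 9.5, a closed
formula for the class number, general `n`.

## References

* [HertlingLarabi2026b] C. Hertling, K. Larabi, *Conjugacy classes of regular integer matrices*, arXiv:2602.15748
  (2026), §9.1 (9.1)–(9.2) (chunk p0027), §9.3 Lemma 9.6 and Remarks 9.7 (chunks p0030–p0031), §9.4 (chunks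
  p0031–p0032), §6 Thm. 6.3 (chunk p0012). [cite: HertlingLarabi2026b, §9.3 Lemma 9.6 (a) and Rem. 9.7 (iii)]
* [HertlingLarabi2026] C. Hertling, K. Larabi, *Semigroups from full lattices in commutative ℚ-algebras*,
  arXiv:2602.14973 (2026) (the `ε`-class language).
-/

open Matrix Polynomial

namespace Literature.LinearAlgebra.Matrix.GL3ZDistinctIntegerEigenvalues

open Literature.LinearAlgebra.Matrix.GL3ZIntegerEigenvalues (exists_conj_upperTriangular triangular_shear₁₂_conj
  triangular_shear₂₃_conj triangular_shear₁₃_conj triangular_diag_conj charpoly_triangular)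
open Literature.LinearAlgebra.Matrix.LatimerMacDuffeeOrderStrata (equivalence_conj)

/-! ## §0 The conjugacy relation -/

/-- Transitivity of `GL₃(ℤ)`-conjugacy. [folklore] -/
private theorem conj_trans {B B' B'' : Matrix (Fin 3) (Fin 3) ℤ}
    (h : ∃ P : Matrix (Fin 3) (Fin 3) ℤ, IsUnit P.det ∧ P * B = B' * P)
    (h' : ∃ P : Matrix (Fin 3) (Fin 3) ℤ, IsUnit P.det ∧ P * B' = B'' * P) :
    ∃ P : Matrix (Fin 3) (Fin 3) ℤ, IsUnit P.det ∧ P * B = B'' * P := by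
  obtain ⟨P, hP, h⟩ := h
  obtain ⟨Q, hQ, h'⟩ := h'
  refine ⟨Q * P, by rw [Matrix.det_mul]; exact hQ.mul hP, ?_⟩
  rw [Matrix.mul_assoc, h, ← Matrix.mul_assoc, h', Matrix.mul_assoc]

/-- Symmetry of `GL₃(ℤ)`-conjugacy. [folklore] -/
private theorem conj_symm {B B' : Matrix (Fin 3) (Fin 3) ℤ}
    (h : ∃ P : Matrix (Fin 3) (Fin 3) ℤ, IsUnit P.det ∧ P * B = B' * P) :
    ∃ P : Matrix (Fin 3) (Fin 3) ℤ, IsUnit P.det ∧ P * B' = B * P := by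
  obtain ⟨P, hP, hPB⟩ := h
  refine ⟨P⁻¹, Matrix.isUnit_nonsing_inv_det P hP, ?_⟩
  calc P⁻¹ * B' = P⁻¹ * B' * (P * P⁻¹) := by rw [Matrix.mul_nonsing_inv P hP, Matrix.mul_one]
    _ = P⁻¹ * (B' * P) * P⁻¹ := by simp only [Matrix.mul_assoc]
    _ = P⁻¹ * (P * B) * P⁻¹ := by rw [hPB]
    _ = B * P⁻¹ := by rw [← Matrix.mul_assoc, Matrix.nonsing_inv_mul P hP, Matrix.one_mul]

/-- Reflexivity of `GL₃(ℤ)`-conjugacy. [folklore] -/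
private theorem conj_refl (B : Matrix (Fin 3) (Fin 3) ℤ) :
    ∃ P : Matrix (Fin 3) (Fin 3) ℤ, IsUnit P.det ∧ P * B = B * P :=
  ⟨1, by simp, by rw [Matrix.one_mul, Matrix.mul_one]⟩

/-! ## §1 Conjugators between triangular forms with the same distinct diagonal are upper triangular -/

/-- **Structure of a conjugator.** If `P·T(a, b, c) = T(a′, b′, c′)·P` for
`T(a, b, c) = (λ₁ a b; 0 λ₂ c; 0 0 λ₃)` with pairwise different `λᵢ`, then `P` is upper triangular (it maps the flag
`ℚe₁ ⊂ ℚe₁ ⊕ ℚe₂` of invariant subspaces to itself) and the off-diagonal entry equations read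
`a′P₁₁ = P₀₀a − P₀₁(λ₁ − λ₂)`, `c′P₂₂ = P₁₁c − P₁₂(λ₂ − λ₃)`, `b′P₂₂ = P₀₀b + P₀₁c − P₀₂(λ₁ − λ₃) − a′P₁₂`.
[cite: HertlingLarabi2026b, §9.3 Lemma 9.6 (a) («The `ℤ`-basis is unique»), chunk p0030] -/
theorem upper_of_conj {l₁ l₂ l₃ a b c a' b' c' : ℤ} (h₁₂ : l₁ ≠ l₂) (h₂₃ : l₂ ≠ l₃) (h₁₃ : l₁ ≠ l₃)
    {P : Matrix (Fin 3) (Fin 3) ℤ}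
    (h : P * !![l₁, a, b; 0, l₂, c; 0, 0, l₃] = !![l₁, a', b'; 0, l₂, c'; 0, 0, l₃] * P) :
    P 1 0 = 0 ∧ P 2 0 = 0 ∧ P 2 1 = 0 ∧ a' * P 1 1 = P 0 0 * a - P 0 1 * (l₁ - l₂) ∧
      c' * P 2 2 = P 1 1 * c - P 1 2 * (l₂ - l₃) ∧
      b' * P 2 2 = P 0 0 * b + P 0 1 * c - P 0 2 * (l₁ - l₃) - a' * P 1 2 := by
  have e := fun i j => congr_fun (congr_fun h i) j
  have h20 : P 2 0 = 0 := by
    have := e 2 0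
    simp [Matrix.mul_apply, Fin.sum_univ_three] at this
    have h' : P 2 0 * (l₁ - l₃) = 0 := by linear_combination this
    exact (mul_eq_zero.1 h').resolve_right (sub_ne_zero.2 h₁₃)
  have h21 : P 2 1 = 0 := by
    have := e 2 1
    simp [Matrix.mul_apply, Fin.sum_univ_three, h20] at this
    have h' : P 2 1 * (l₂ - l₃) = 0 := by linear_combination this
    exact (mul_eq_zero.1 h').resolve_right (sub_ne_zero.2 h₂₃)
  have h10 : P 1 0 = 0 := by
    have := e 1 0
    simp [Matrix.mul_apply, Fin.sum_univ_three, h20] at this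
    have h' : P 1 0 * (l₁ - l₂) = 0 := by linear_combination this
    exact (mul_eq_zero.1 h').resolve_right (sub_ne_zero.2 h₁₂)
  refine ⟨h10, h20, h21, ?_, ?_, ?_⟩
  · have := e 0 1
    simp [Matrix.mul_apply, Fin.sum_univ_three, h21] at this
    linear_combination -this
  · have := e 1 2
    simp [Matrix.mul_apply, Fin.sum_univ_three, h10] at this
    linear_combination -this
  · have := e 0 2
    simp [Matrix.mul_apply, Fin.sum_univ_three] at this
    linear_combination -this

/-- The diagonal of a unimodular conjugator consists of units: `P₀₀² = P₁₁² = P₂₂² = 1`.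
[cite: HertlingLarabi2026b, §9.1 (9.2) («with suitable signs `ε₁, ..., εₙ ∈ {±1}`»), chunk p0027] -/
theorem diag_mul_self_eq_one_of_conj {l₁ l₂ l₃ a b c a' b' c' : ℤ} (h₁₂ : l₁ ≠ l₂) (h₂₃ : l₂ ≠ l₃)
    (h₁₃ : l₁ ≠ l₃) {P : Matrix (Fin 3) (Fin 3) ℤ} (hP : IsUnit P.det)
    (h : P * !![l₁, a, b; 0, l₂, c; 0, 0, l₃] = !![l₁, a', b'; 0, l₂, c'; 0, 0, l₃] * P) :
    P 0 0 * P 0 0 = 1 ∧ P 1 1 * P 1 1 = 1 ∧ P 2 2 * P 2 2 = 1 := by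
  obtain ⟨h10, h20, h21, -⟩ := upper_of_conj h₁₂ h₂₃ h₁₃ h
  have hdet : P.det = P 0 0 * P 1 1 * P 2 2 := by
    rw [Matrix.det_fin_three, h10, h20, h21]; ring
  rw [hdet] at hP
  exact ⟨Int.isUnit_mul_self (isUnit_of_mul_isUnit_left (isUnit_of_mul_isUnit_left hP)),
    Int.isUnit_mul_self (isUnit_of_mul_isUnit_right (isUnit_of_mul_isUnit_left hP)),
    Int.isUnit_mul_self (isUnit_of_mul_isUnit_right hP)⟩

/-- **The quantity `B := b(λ₁ − λ₂) + ac` transforms like a coordinate**: if `P·T(a, b, c) = T(a′, b′, c′)·P` with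
`P ∈ GL₃(ℤ)` then `B′ = P₀₀P₂₂·B − P₂₂(λ₁ − λ₃)(a′P₁₂ + (λ₁ − λ₂)P₀₂)`.  In HL's coordinates (9.16),
`δ₁ = a/(λ₁ − λ₂)`, `δ₂ = c/(λ₂ − λ₃)`, `δ₃ = B/((λ₁ − λ₂)(λ₁ − λ₃))`: the third basis vector `δ₃e₁ + δ₂e₂ + e₃` changes
by multiples of the first two and by the sign `ε₁ε₃`. [cite: HertlingLarabi2026b, §9.3 Lemma 9.6 (a) (9.16), chunk p0030] -/
theorem bInv_eq_of_conj {l₁ l₂ l₃ a b c a' b' c' : ℤ} (h₁₂ : l₁ ≠ l₂) (h₂₃ : l₂ ≠ l₃) (h₁₃ : l₁ ≠ l₃)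
    {P : Matrix (Fin 3) (Fin 3) ℤ} (hP : IsUnit P.det)
    (h : P * !![l₁, a, b; 0, l₂, c; 0, 0, l₃] = !![l₁, a', b'; 0, l₂, c'; 0, 0, l₃] * P) :
    b' * (l₁ - l₂) + a' * c' = P 0 0 * P 2 2 * (b * (l₁ - l₂) + a * c) - P 2 2 * P 1 2 * (a' * (l₁ - l₃)) -
      P 2 2 * P 0 2 * ((l₁ - l₂) * (l₁ - l₃)) := by
  obtain ⟨-, -, -, e1, e2, e3⟩ := upper_of_conj h₁₂ h₂₃ h₁₃ h
  obtain ⟨-, -, u2⟩ := diag_mul_self_eq_one_of_conj h₁₂ h₂₃ h₁₃ hP h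
  linear_combination (-((l₁ - l₂) * b')) * u2 + ((l₁ - l₂) * P 2 2) * e3 + (-(a' * c')) * u2 +
    (a' * P 2 2) * e2 + (P 2 2 * c) * e1

/-! ## §2 The moves, with their effect on `(a, c, B)` -/

/-- `δ₁ ↦ δ₁ − k`: `(a, b, c) ↦ (a − k(λ₁ − λ₂), b + kc, c)`; `B` and `c` unchanged. [cite: HertlingLarabi2026b, §9.1 (9.1)–(9.2), chunk p0027] -/
theorem move₁ (l₁ l₂ l₃ a b c k : ℤ) :
    ∃ P : Matrix (Fin 3) (Fin 3) ℤ, IsUnit P.det ∧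
      P * !![l₁, a, b; 0, l₂, c; 0, 0, l₃] = !![l₁, a - k * (l₁ - l₂), b + k * c; 0, l₂, c; 0, 0, l₃] * P := by
  have h := triangular_shear₁₂_conj l₁ l₂ l₃ a b c k
  have e : a + k * (l₂ - l₁) = a - k * (l₁ - l₂) := by ring
  rwa [e] at h

/-- `δ₂ ↦ δ₂ − k`, `δ₃ ↦ δ₃ − kδ₁`: `(a, b, c) ↦ (a, b − ka, c − k(λ₂ − λ₃))`; `B ↦ B − ka(λ₁ − λ₃)`.
[cite: HertlingLarabi2026b, §9.1 (9.1)–(9.2), chunk p0027] -/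
theorem move₂ (l₁ l₂ l₃ a b c k : ℤ) :
    ∃ P : Matrix (Fin 3) (Fin 3) ℤ, IsUnit P.det ∧
      P * !![l₁, a, b; 0, l₂, c; 0, 0, l₃] = !![l₁, a, b - k * a; 0, l₂, c - k * (l₂ - l₃); 0, 0, l₃] * P := by
  have h := triangular_shear₂₃_conj l₁ l₂ l₃ a b c k
  have e : c + k * (l₃ - l₂) = c - k * (l₂ - l₃) := by ring
  rwa [e] at h

/-- `δ₃ ↦ δ₃ − k`: `(a, b, c) ↦ (a, b − k(λ₁ − λ₃), c)`; `B ↦ B − k(λ₁ − λ₂)(λ₁ − λ₃)`.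
[cite: HertlingLarabi2026b, §9.1 (9.1)–(9.2), chunk p0027] -/
theorem move₃ (l₁ l₂ l₃ a b c k : ℤ) :
    ∃ P : Matrix (Fin 3) (Fin 3) ℤ, IsUnit P.det ∧
      P * !![l₁, a, b; 0, l₂, c; 0, 0, l₃] = !![l₁, a, b - k * (l₁ - l₃); 0, l₂, c; 0, 0, l₃] * P := by
  have h := triangular_shear₁₃_conj l₁ l₂ l₃ a b c k
  have e : b + k * (l₃ - l₁) = b - k * (l₁ - l₃) := by ring
  rwa [e] at h

/-- The unit `−e₁ + e₂ + e₃`: `(a, b, c) ↦ (−a, −b, c)`; `B ↦ −B`, `c` unchanged. [cite: HertlingLarabi2026b, §9.3 proof of Lemma 9.6 (a) («a suitable unit `u ∈ {±e₁ ± e₂ ± e₃}`»), chunk p0030] -/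
theorem sign₁ (l₁ l₂ l₃ a b c : ℤ) :
    ∃ P : Matrix (Fin 3) (Fin 3) ℤ, IsUnit P.det ∧
      P * !![l₁, a, b; 0, l₂, c; 0, 0, l₃] = !![l₁, -a, -b; 0, l₂, c; 0, 0, l₃] * P := by
  simpa using triangular_diag_conj l₁ l₂ l₃ a b c (ε₁ := -1) (ε₂ := 1) (ε₃ := 1) (by norm_num) (by norm_num)
    (by norm_num)

/-- The unit `e₁ − e₂ + e₃`: `(a, b, c) ↦ (−a, b, −c)`; `B` unchanged. [cite: HertlingLarabi2026b, §9.3 proof of Lemma 9.6 (a), chunk p0030] -/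
theorem sign₂ (l₁ l₂ l₃ a b c : ℤ) :
    ∃ P : Matrix (Fin 3) (Fin 3) ℤ, IsUnit P.det ∧
      P * !![l₁, a, b; 0, l₂, c; 0, 0, l₃] = !![l₁, -a, b; 0, l₂, -c; 0, 0, l₃] * P := by
  simpa using triangular_diag_conj l₁ l₂ l₃ a b c (ε₁ := 1) (ε₂ := -1) (ε₃ := 1) (by norm_num) (by norm_num)
    (by norm_num)

/-- The unit `e₁ + e₂ − e₃`: `(a, b, c) ↦ (a, −b, −c)`; `B ↦ −B`. [cite: HertlingLarabi2026b, §9.3 proof of Lemma 9.6 (a), chunk p0030] -/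
theorem sign₃ (l₁ l₂ l₃ a b c : ℤ) :
    ∃ P : Matrix (Fin 3) (Fin 3) ℤ, IsUnit P.det ∧
      P * !![l₁, a, b; 0, l₂, c; 0, 0, l₃] = !![l₁, a, -b; 0, l₂, -c; 0, 0, l₃] * P := by
  simpa using triangular_diag_conj l₁ l₂ l₃ a b c (ε₁ := 1) (ε₂ := 1) (ε₃ := -1) (by norm_num) (by norm_num)
    (by norm_num)


/-- The composite move `ρ` for `δ₂ = ½` (`2c = λ₂ − λ₃`): the unit `e₁ + e₂ − e₃` followed by `δ₂ ↦ δ₂ + 1` gives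
`(a, b, c) ↦ (a, a − b, c)`, i.e. `B ↦ a(λ₁ − λ₃) − B` with `a`, `c` unchanged — the move behind the extra conditions
in the boundary cases `δ₂ = ½` of (9.17). [cite: HertlingLarabi2026b, §9.3 proof of Lemma 9.6 (a) («In the special case […] we replace `½e₁ + ½e₂ + e₃` by `(½−½)e₁ + (½−1)e₂ + e₃`»), chunk p0030] -/
theorem rho_conj (l₁ l₂ l₃ a b c : ℤ) (hc : 2 * c = l₂ - l₃) :
    ∃ P : Matrix (Fin 3) (Fin 3) ℤ, IsUnit P.det ∧
      P * !![l₁, a, b; 0, l₂, c; 0, 0, l₃] = !![l₁, a, a - b; 0, l₂, c; 0, 0, l₃] * P := by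
  have h₁ := sign₃ l₁ l₂ l₃ a b c
  have h₂ := move₂ l₁ l₂ l₃ a (-b) (-c) (-1)
  have e₁ : -b - -1 * a = a - b := by ring
  have e₂ : -c - -1 * (l₂ - l₃) = c := by linarith
  rw [e₁, e₂] at h₂
  exact conj_trans h₁ h₂

/-- Under `ρ`, `B = b(λ₁ − λ₂) + ac ↦ a(λ₁ − λ₃) − B` (`δ₃ ↦ δ₁ − δ₃`). [cite: HertlingLarabi2026b, §9.3 proof of Lemma 9.6 (a), chunk p0030] -/
theorem rho_bInv (l₁ l₂ l₃ a b c : ℤ) (hc : 2 * c = l₂ - l₃) :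
    (a - b) * (l₁ - l₂) + a * c = a * (l₁ - l₃) - (b * (l₁ - l₂) + a * c) := by linear_combination a * hc

/-- The composite move `φ`: the unit `−e₁ + e₂ + e₃` followed by `δ₃ ↦ δ₃ + 1`, `δ₁ ↦ δ₁ + 1`:
`(a, b, c) ↦ (λ₁ − λ₂ − a, λ₁ − λ₃ − b − c, c)`, i.e. `δ₁ ↦ 1 − δ₁`, `δ₃ ↦ 1 − δ₃`, `δ₂` unchanged.
[cite: HertlingLarabi2026b, §9.3 proof of Lemma 9.6 (a) («The full lattice `(−e₁+e₂+e₃)L` has the `ℤ`-basis `e(1 1−δ₁ ½; 0 1 δ₂; 0 0 1)`»), chunk p0030] -/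
theorem flip_conj (l₁ l₂ l₃ a b c : ℤ) :
    ∃ P : Matrix (Fin 3) (Fin 3) ℤ, IsUnit P.det ∧
      P * !![l₁, a, b; 0, l₂, c; 0, 0, l₃] = !![l₁, l₁ - l₂ - a, l₁ - l₃ - b - c; 0, l₂, c; 0, 0, l₃] * P := by
  have h₁ := sign₁ l₁ l₂ l₃ a b c
  have h₂ := move₃ l₁ l₂ l₃ (-a) (-b) c (-1)
  have h₃ := move₁ l₁ l₂ l₃ (-a) (-b - -1 * (l₁ - l₃)) c (-1)
  have e₁ : -a - -1 * (l₁ - l₂) = l₁ - l₂ - a := by ring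
  have e₂ : -b - -1 * (l₁ - l₃) + -1 * c = l₁ - l₃ - b - c := by ring
  rw [e₁, e₂] at h₃
  exact conj_trans h₁ (conj_trans h₂ h₃)

/-- Under `φ`, `B ↦ (λ₁ − λ₂)(λ₁ − λ₃) − B`. [cite: HertlingLarabi2026b, §9.3 proof of Lemma 9.6 (a), chunk p0030] -/
theorem flip_bInv (l₁ l₂ l₃ a b c : ℤ) :
    (l₁ - l₃ - b - c) * (l₁ - l₂) + (l₁ - l₂ - a) * c = (l₁ - l₂) * (l₁ - l₃) - (b * (l₁ - l₂) + a * c) := by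
  ring

/-- The composite move `φ₀`: the unit `−e₁ + e₂ + e₃` followed by `δ₁ ↦ δ₁ + 1`:
`(a, b, c) ↦ (λ₁ − λ₂ − a, −b − c, c)`, `B ↦ −B`. [cite: HertlingLarabi2026b, §9.3 proof of Lemma 9.6 (a) («The case `(δ₂, δ₃) ∈ [0, ½] × {0}`»), chunk p0030] -/
theorem flip₀_conj (l₁ l₂ l₃ a b c : ℤ) :
    ∃ P : Matrix (Fin 3) (Fin 3) ℤ, IsUnit P.det ∧
      P * !![l₁, a, b; 0, l₂, c; 0, 0, l₃] = !![l₁, l₁ - l₂ - a, -b - c; 0, l₂, c; 0, 0, l₃] * P := by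
  have h₁ := sign₁ l₁ l₂ l₃ a b c
  have h₂ := move₁ l₁ l₂ l₃ (-a) (-b) c (-1)
  have e₁ : -a - -1 * (l₁ - l₂) = l₁ - l₂ - a := by ring
  have e₂ : -b + -1 * c = -b - c := by ring
  rw [e₁, e₂] at h₂
  exact conj_trans h₁ h₂

/-- The composite move `φ_c` for `c = 0` (`δ₂ = 0`): the unit `e₁ − e₂ + e₃` followed by `δ₁ ↦ δ₁ + 1`:
`(a, b, 0) ↦ (λ₁ − λ₂ − a, b, 0)`, `B` unchanged. [cite: HertlingLarabi2026b, §9.3 proof of Lemma 9.6 (a) («The case `(δ₂, δ₃) ∈ {0} × (0, ½]` […] The full lattice `(e₁−e₂+e₃)L` has the `ℤ`-basis `e(1 1−δ₁ δ₃; 0 1 0; 0 0 1)`»), chunk p0030] -/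
theorem flipc_conj (l₁ l₂ l₃ a b : ℤ) :
    ∃ P : Matrix (Fin 3) (Fin 3) ℤ, IsUnit P.det ∧
      P * !![l₁, a, b; 0, l₂, 0; 0, 0, l₃] = !![l₁, l₁ - l₂ - a, b; 0, l₂, 0; 0, 0, l₃] * P := by
  have h₁ := sign₂ l₁ l₂ l₃ a b 0
  have h₂ := move₁ l₁ l₂ l₃ (-a) b 0 (-1)
  have e₁ : -a - -1 * (l₁ - l₂) = l₁ - l₂ - a := by ring
  rw [neg_zero] at h₁
  rw [e₁, mul_zero, add_zero] at h₂
  exact conj_trans h₁ h₂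

/-! ## §3 Existence of the normal form -/

/-- Step 1, `δ₂ ∈ [0, ½]`: `c ↦ c mod (λ₂ − λ₃)`, then if `2c > λ₂ − λ₃` the unit `e₁ + e₂ − e₃` and `c ↦ c + (λ₂ − λ₃)`.
[cite: HertlingLarabi2026b, §9.1 (9.2) («`δ_{in} ∈ [0, ½]`»), chunk p0027] -/
private theorem step_c (l₁ a b c : ℤ) {l₂ l₃ : ℤ} (h₂₃ : l₃ < l₂) :
    ∃ a' b' c' : ℤ, (0 ≤ c' ∧ 2 * c' ≤ l₂ - l₃) ∧ ∃ P : Matrix (Fin 3) (Fin 3) ℤ, IsUnit P.det ∧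
      P * !![l₁, a, b; 0, l₂, c; 0, 0, l₃] = !![l₁, a', b'; 0, l₂, c'; 0, 0, l₃] * P := by
  have hd : 0 < l₂ - l₃ := sub_pos.2 h₂₃
  have e : c - c / (l₂ - l₃) * (l₂ - l₃) = c % (l₂ - l₃) := by rw [Int.emod_def]; ring
  have h0 : 0 ≤ c % (l₂ - l₃) := Int.emod_nonneg _ hd.ne'
  have h1 : c % (l₂ - l₃) < l₂ - l₃ := Int.emod_lt_of_pos _ hd
  have hc₁ := move₂ l₁ l₂ l₃ a b c (c / (l₂ - l₃))
  rw [e] at hc₁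
  by_cases h2 : 2 * (c % (l₂ - l₃)) ≤ l₂ - l₃
  · exact ⟨_, _, _, ⟨h0, h2⟩, hc₁⟩
  · have hc₂ := sign₃ l₁ l₂ l₃ a (b - c / (l₂ - l₃) * a) (c % (l₂ - l₃))
    have hc₃ := move₂ l₁ l₂ l₃ a (-(b - c / (l₂ - l₃) * a)) (-(c % (l₂ - l₃))) (-1)
    exact ⟨_, _, _, ⟨by linarith, by linarith⟩, conj_trans hc₁ (conj_trans hc₂ hc₃)⟩

/-- Step 2, `δ₃ ∈ [0, ½]` (with `δ₂` fixed): `B ↦ B mod (λ₁ − λ₂)(λ₁ − λ₃)` by `1 + ke₁₃`, then if `2B > (λ₁ − λ₂)(λ₁ − λ₃)`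
the unit `−e₁ + e₂ + e₃` and `B ↦ B + (λ₁ − λ₂)(λ₁ − λ₃)`. [cite: HertlingLarabi2026b, §9.1 (9.2), chunk p0027] -/
private theorem step_B (a b c : ℤ) {l₁ l₂ l₃ : ℤ} (h₁₂ : l₂ < l₁) (h₂₃ : l₃ < l₂) :
    ∃ a' b' : ℤ, (0 ≤ b' * (l₁ - l₂) + a' * c ∧ 2 * (b' * (l₁ - l₂) + a' * c) ≤ (l₁ - l₂) * (l₁ - l₃)) ∧
      ∃ P : Matrix (Fin 3) (Fin 3) ℤ, IsUnit P.det ∧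
        P * !![l₁, a, b; 0, l₂, c; 0, 0, l₃] = !![l₁, a', b'; 0, l₂, c; 0, 0, l₃] * P := by
  obtain ⟨m, hm⟩ : ∃ m, (l₁ - l₂) * (l₁ - l₃) = m := ⟨_, rfl⟩
  have hm0 : 0 < m := by rw [← hm]; exact mul_pos (by linarith) (by linarith)
  obtain ⟨B, hB⟩ : ∃ B, b * (l₁ - l₂) + a * c = B := ⟨_, rfl⟩
  have h0 : 0 ≤ B % m := Int.emod_nonneg _ hm0.ne'
  have h1 : B % m < m := Int.emod_lt_of_pos _ hm0
  have hc₁ := move₃ l₁ l₂ l₃ a b c (B / m)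
  have e₁ : (b - B / m * (l₁ - l₃)) * (l₁ - l₂) + a * c = B % m := by
    rw [Int.emod_def]; linear_combination hB - (B / m) * hm
  by_cases h2 : 2 * (B % m) ≤ m
  · exact ⟨a, b - B / m * (l₁ - l₃), ⟨by rw [e₁]; exact h0, by rw [e₁, hm]; exact h2⟩, hc₁⟩
  · have hc₂ := sign₁ l₁ l₂ l₃ a (b - B / m * (l₁ - l₃)) c
    have hc₃ := move₃ l₁ l₂ l₃ (-a) (-(b - B / m * (l₁ - l₃))) c (-1)
    have e₂ : (-(b - B / m * (l₁ - l₃)) - -1 * (l₁ - l₃)) * (l₁ - l₂) + -a * c = m - B % m := by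
      rw [Int.emod_def]; linear_combination (-1 : ℤ) * hB + (B / m + 1) * hm
    exact ⟨-a, -(b - B / m * (l₁ - l₃)) - -1 * (l₁ - l₃), ⟨by rw [e₂]; linarith, by rw [e₂, hm]; linarith⟩,
      conj_trans hc₁ (conj_trans hc₂ hc₃)⟩

/-- Step 3, `δ₁ ∈ [0, 1)` (with `δ₂`, `δ₃` fixed): `a ↦ a mod (λ₁ − λ₂)` by `1 + ke₁₂`; `B` is unchanged.
[cite: HertlingLarabi2026b, §9.1 (9.2), chunk p0027] -/
private theorem step_a (l₃ a b c : ℤ) {l₁ l₂ : ℤ} (h₁₂ : l₂ < l₁) :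
    ∃ a' b' : ℤ, (0 ≤ a' ∧ a' < l₁ - l₂) ∧ b' * (l₁ - l₂) + a' * c = b * (l₁ - l₂) + a * c ∧
      ∃ P : Matrix (Fin 3) (Fin 3) ℤ, IsUnit P.det ∧
        P * !![l₁, a, b; 0, l₂, c; 0, 0, l₃] = !![l₁, a', b'; 0, l₂, c; 0, 0, l₃] * P := by
  have hd : 0 < l₁ - l₂ := sub_pos.2 h₁₂
  have e : a - a / (l₁ - l₂) * (l₁ - l₂) = a % (l₁ - l₂) := by rw [Int.emod_def]; ring
  refine ⟨a - a / (l₁ - l₂) * (l₁ - l₂), b + a / (l₁ - l₂) * c, ⟨?_, ?_⟩, by ring,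
    move₁ l₁ l₂ l₃ a b c (a / (l₁ - l₂))⟩
  · rw [e]; exact Int.emod_nonneg _ hd.ne'
  · rw [e]; exact Int.emod_lt_of_pos _ hd

/-- Step 4, the boundary cases `δ₂ = 0`, `δ₃ ∈ {0, ½}`: there `δ₁ ↦ 1 − δ₁` is available (`φ_c`, `φ₀`, `φ`), so
`δ₁ ∈ [0, ½]` can be arranged, keeping `δ₂`, `δ₃`. [cite: HertlingLarabi2026b, §9.3 proof of Lemma 9.6 (a), chunk p0030] -/
private theorem step_N4 {l₁ l₂ : ℤ} (l₃ b c : ℤ) {a : ℤ} (ha : 0 ≤ a ∧ a < l₁ - l₂) :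
    ∃ a' b' : ℤ, (0 ≤ a' ∧ a' < l₁ - l₂) ∧ b' * (l₁ - l₂) + a' * c = b * (l₁ - l₂) + a * c ∧
      ((c = 0 ∨ b' * (l₁ - l₂) + a' * c = 0 ∨ 2 * (b' * (l₁ - l₂) + a' * c) = (l₁ - l₂) * (l₁ - l₃)) →
        2 * a' ≤ l₁ - l₂) ∧
      ∃ P : Matrix (Fin 3) (Fin 3) ℤ, IsUnit P.det ∧
        P * !![l₁, a, b; 0, l₂, c; 0, 0, l₃] = !![l₁, a', b'; 0, l₂, c; 0, 0, l₃] * P := by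
  by_cases h2a : 2 * a ≤ l₁ - l₂
  · exact ⟨a, b, ha, rfl, fun _ => h2a, conj_refl _⟩
  rcases em (c = 0) with hc0 | hc0
  · subst hc0
    exact ⟨l₁ - l₂ - a, b, ⟨by omega, by omega⟩, by ring, fun _ => by omega, flipc_conj l₁ l₂ l₃ a b⟩
  rcases em (b * (l₁ - l₂) + a * c = 0) with hB0 | hB0
  · refine ⟨l₁ - l₂ - a, -b - c, ⟨by omega, by omega⟩, by linear_combination (-2 : ℤ) * hB0, fun _ => by omega,
      flip₀_conj l₁ l₂ l₃ a b c⟩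
  rcases em (2 * (b * (l₁ - l₂) + a * c) = (l₁ - l₂) * (l₁ - l₃)) with hB2 | hB2
  · refine ⟨l₁ - l₂ - a, l₁ - l₃ - b - c, ⟨by omega, by omega⟩, by linear_combination (-1 : ℤ) * hB2,
      fun _ => by omega, flip_conj l₁ l₂ l₃ a b c⟩
  exact ⟨a, b, ha, rfl, fun h => by omega, conj_refl _⟩


/-- Step 5a, the sub-case `(δ₂, δ₃) = (½, 0)` with `δ₁ ∉ {0, ½}`: `ρ` moves to `(δ₁, ½, δ₁)`, which is a normal form
(this is the sub-case where the printed (9.17) over-counts). [cite: HertlingLarabi2026b, §9.3 Lemma 9.6 (a) (9.17), chunk p0030] -/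
private theorem step_half₁ {l₁ l₂ l₃ a b c : ℤ} (h₁₂ : l₂ < l₁) (h₂₃ : l₃ < l₂) (hc : 0 ≤ c ∧ 2 * c ≤ l₂ - l₃)
    (ha : 0 ≤ a ∧ a < l₁ - l₂) (h2a : 2 * a ≤ l₁ - l₂) (hhalf : 2 * c = l₂ - l₃)
    (hB0 : b * (l₁ - l₂) + a * c = 0) (hn : ¬(a = 0 ∨ 2 * a = l₁ - l₂)) :
    ∃ a' b' : ℤ, ((0 ≤ c ∧ 2 * c ≤ l₂ - l₃) ∧
        (0 ≤ b' * (l₁ - l₂) + a' * c ∧ 2 * (b' * (l₁ - l₂) + a' * c) ≤ (l₁ - l₂) * (l₁ - l₃)) ∧ (0 ≤ a' ∧ a' < l₁ - l₂) ∧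
        ((c = 0 ∨ b' * (l₁ - l₂) + a' * c = 0 ∨ 2 * (b' * (l₁ - l₂) + a' * c) = (l₁ - l₂) * (l₁ - l₃)) → 2 * a' ≤ l₁ - l₂) ∧
        (2 * c = l₂ - l₃ → b' * (l₁ - l₂) + a' * c = 0 → (a' = 0 ∨ 2 * a' = l₁ - l₂)) ∧
        (2 * c = l₂ - l₃ → 2 * (b' * (l₁ - l₂) + a' * c) = (l₁ - l₂) * (l₁ - l₃) → 2 * a' < l₁ - l₂) ∧
        (2 * c = l₂ - l₃ → 0 < b' * (l₁ - l₂) + a' * c → 2 * (b' * (l₁ - l₂) + a' * c) < (l₁ - l₂) * (l₁ - l₃) →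
          a' * (l₁ - l₃) ≤ 2 * (b' * (l₁ - l₂) + a' * c))) ∧
      ∃ P : Matrix (Fin 3) (Fin 3) ℤ, IsUnit P.det ∧
        P * !![l₁, a, b; 0, l₂, c; 0, 0, l₃] = !![l₁, a', b'; 0, l₂, c; 0, 0, l₃] * P := by
  have hρ := rho_bInv l₁ l₂ l₃ a b c hhalf
  have had0 : 0 < a * (l₁ - l₃) := mul_pos (by omega) (by omega)
  have h2ad : 2 * (a * (l₁ - l₃)) ≤ (l₁ - l₂) * (l₁ - l₃) := by
    rw [← mul_assoc]; exact mul_le_mul_of_nonneg_right h2a (by omega)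
  have hne : 2 * (a * (l₁ - l₃)) ≠ (l₁ - l₂) * (l₁ - l₃) := fun h =>
    hn (Or.inr (mul_right_cancel₀ (show (l₁ - l₃) ≠ 0 by omega) (by rw [← h, mul_assoc])))
  exact ⟨a, a - b, ⟨hc, ⟨by omega, by omega⟩, ha, fun _ => h2a, fun _ _ => by omega, fun _ _ => by omega,
    fun _ _ _ => by omega⟩, rho_conj l₁ l₂ l₃ a b c hhalf⟩

/-- Step 5b, the sub-case `(δ₁, δ₂, δ₃) = (½, ½, ½)`: `ρ` moves to `(½, ½, 0)`, a normal form.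
[cite: HertlingLarabi2026b, §9.3 proof of Lemma 9.6 (a) («In the special case `(δ₁, δ₂, δ₃) = (½, ½, ½)` …»), chunk p0030] -/
private theorem step_half₂ {l₁ l₂ l₃ a b c : ℤ} (h₁₂ : l₂ < l₁) (h₂₃ : l₃ < l₂) (hc : 0 ≤ c ∧ 2 * c ≤ l₂ - l₃)
    (ha : 0 ≤ a ∧ a < l₁ - l₂) (hhalf : 2 * c = l₂ - l₃)
    (hB2 : 2 * (b * (l₁ - l₂) + a * c) = (l₁ - l₂) * (l₁ - l₃)) (h2a : 2 * a = l₁ - l₂) :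
    ∃ a' b' : ℤ, ((0 ≤ c ∧ 2 * c ≤ l₂ - l₃) ∧
        (0 ≤ b' * (l₁ - l₂) + a' * c ∧ 2 * (b' * (l₁ - l₂) + a' * c) ≤ (l₁ - l₂) * (l₁ - l₃)) ∧ (0 ≤ a' ∧ a' < l₁ - l₂) ∧
        ((c = 0 ∨ b' * (l₁ - l₂) + a' * c = 0 ∨ 2 * (b' * (l₁ - l₂) + a' * c) = (l₁ - l₂) * (l₁ - l₃)) → 2 * a' ≤ l₁ - l₂) ∧
        (2 * c = l₂ - l₃ → b' * (l₁ - l₂) + a' * c = 0 → (a' = 0 ∨ 2 * a' = l₁ - l₂)) ∧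
        (2 * c = l₂ - l₃ → 2 * (b' * (l₁ - l₂) + a' * c) = (l₁ - l₂) * (l₁ - l₃) → 2 * a' < l₁ - l₂) ∧
        (2 * c = l₂ - l₃ → 0 < b' * (l₁ - l₂) + a' * c → 2 * (b' * (l₁ - l₂) + a' * c) < (l₁ - l₂) * (l₁ - l₃) →
          a' * (l₁ - l₃) ≤ 2 * (b' * (l₁ - l₂) + a' * c))) ∧
      ∃ P : Matrix (Fin 3) (Fin 3) ℤ, IsUnit P.det ∧
        P * !![l₁, a, b; 0, l₂, c; 0, 0, l₃] = !![l₁, a', b'; 0, l₂, c; 0, 0, l₃] * P := by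
  have hρ := rho_bInv l₁ l₂ l₃ a b c hhalf
  have hm0 : 0 < (l₁ - l₂) * (l₁ - l₃) := mul_pos (by omega) (by omega)
  have h2ad : 2 * (a * (l₁ - l₃)) = (l₁ - l₂) * (l₁ - l₃) := by rw [← h2a, mul_assoc]
  exact ⟨a, a - b, ⟨hc, ⟨by omega, by omega⟩, ha, fun _ => by omega, fun _ _ => Or.inr h2a, fun _ _ => by omega,
    fun _ _ _ => by omega⟩, rho_conj l₁ l₂ l₃ a b c hhalf⟩

/-- Step 5c, the sub-case `δ₂ = ½`, `δ₃ ∈ (0, ½)`, `δ₁ > 2δ₃`: `ρ` moves to `(δ₁, ½, δ₁ − δ₃)`; if `δ₁ − δ₃ < ½` this is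
a normal form, if `δ₁ − δ₃ = ½` then (`δ₁ ≠ ½`) either it is one or `φ` gives one, and if `δ₁ − δ₃ > ½` then `φ` gives
`(1 − δ₁, ½, 1 − δ₁ + δ₃)`, a normal form. [cite: HertlingLarabi2026b, §9.3 Lemma 9.6 (a) (9.17) («`δ₁ ∈ [0, 2δ₃]` if `(δ₂, δ₃) ∈ {½} × (0, ½)`»), chunk p0030] -/
private theorem step_half₃ {l₁ l₂ l₃ a b c : ℤ} (h₁₂ : l₂ < l₁) (h₂₃ : l₃ < l₂) (hc : 0 ≤ c ∧ 2 * c ≤ l₂ - l₃)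
    (ha : 0 ≤ a ∧ a < l₁ - l₂) (hhalf : 2 * c = l₂ - l₃) (hB1 : 0 < b * (l₁ - l₂) + a * c)
    (hB2 : 2 * (b * (l₁ - l₂) + a * c) < (l₁ - l₂) * (l₁ - l₃))
    (hlt : 2 * (b * (l₁ - l₂) + a * c) < a * (l₁ - l₃)) :
    ∃ a' b' : ℤ, ((0 ≤ c ∧ 2 * c ≤ l₂ - l₃) ∧
        (0 ≤ b' * (l₁ - l₂) + a' * c ∧ 2 * (b' * (l₁ - l₂) + a' * c) ≤ (l₁ - l₂) * (l₁ - l₃)) ∧ (0 ≤ a' ∧ a' < l₁ - l₂) ∧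
        ((c = 0 ∨ b' * (l₁ - l₂) + a' * c = 0 ∨ 2 * (b' * (l₁ - l₂) + a' * c) = (l₁ - l₂) * (l₁ - l₃)) → 2 * a' ≤ l₁ - l₂) ∧
        (2 * c = l₂ - l₃ → b' * (l₁ - l₂) + a' * c = 0 → (a' = 0 ∨ 2 * a' = l₁ - l₂)) ∧
        (2 * c = l₂ - l₃ → 2 * (b' * (l₁ - l₂) + a' * c) = (l₁ - l₂) * (l₁ - l₃) → 2 * a' < l₁ - l₂) ∧
        (2 * c = l₂ - l₃ → 0 < b' * (l₁ - l₂) + a' * c → 2 * (b' * (l₁ - l₂) + a' * c) < (l₁ - l₂) * (l₁ - l₃) →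
          a' * (l₁ - l₃) ≤ 2 * (b' * (l₁ - l₂) + a' * c))) ∧
      ∃ P : Matrix (Fin 3) (Fin 3) ℤ, IsUnit P.det ∧
        P * !![l₁, a, b; 0, l₂, c; 0, 0, l₃] = !![l₁, a', b'; 0, l₂, c; 0, 0, l₃] * P := by
  have hρ := rho_bInv l₁ l₂ l₃ a b c hhalf
  have hφ := flip_bInv l₁ l₂ l₃ a (a - b) c
  have hρc := rho_conj l₁ l₂ l₃ a b c hhalf
  have hφc := flip_conj l₁ l₂ l₃ a (a - b) c
  have hm0 : 0 < (l₁ - l₂) * (l₁ - l₃) := mul_pos (by omega) (by omega)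
  have hadm : a * (l₁ - l₃) < (l₁ - l₂) * (l₁ - l₃) := mul_lt_mul_of_pos_right ha.2 (by omega)
  have haz : a = 0 → a * (l₁ - l₃) = 0 := fun h => by rw [h, zero_mul]
  have h2ad : 2 * a = l₁ - l₂ → 2 * (a * (l₁ - l₃)) = (l₁ - l₂) * (l₁ - l₃) := fun h => by rw [← h, mul_assoc]
  have hφa : (l₁ - l₂ - a) * (l₁ - l₃) = (l₁ - l₂) * (l₁ - l₃) - a * (l₁ - l₃) := by ring
  rcases lt_trichotomy (2 * ((a - b) * (l₁ - l₂) + a * c)) ((l₁ - l₂) * (l₁ - l₃)) with hlt' | heq' | hgt'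
  · exact ⟨a, a - b, ⟨hc, ⟨by omega, by omega⟩, ha, fun _ => by omega, fun _ _ => by omega, fun _ _ => by omega,
      fun _ _ _ => by omega⟩, hρc⟩
  · by_cases h2a : 2 * a < l₁ - l₂
    · exact ⟨a, a - b, ⟨hc, ⟨by omega, by omega⟩, ha, fun _ => h2a.le, fun _ _ => by omega, fun _ _ => h2a,
        fun _ _ _ => by omega⟩, hρc⟩
    · exact ⟨l₁ - l₂ - a, l₁ - l₃ - (a - b) - c, ⟨hc, ⟨by omega, by omega⟩, ⟨by omega, by omega⟩,
        fun _ => by omega, fun _ _ => by omega, fun _ _ => by omega, fun _ _ _ => by omega⟩,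
        conj_trans hρc hφc⟩
  · exact ⟨l₁ - l₂ - a, l₁ - l₃ - (a - b) - c, ⟨hc, ⟨by omega, by omega⟩, ⟨by omega, by omega⟩,
      fun _ => by omega, fun _ _ => by omega, fun _ _ => by omega, fun _ _ _ => by omega⟩,
      conj_trans hρc hφc⟩

/-- Step 5, the boundary cases `δ₂ = ½`: from the semi-normal form with (N4) to the normal form, keeping `δ₂`.
[cite: HertlingLarabi2026b, §9.3 Lemma 9.6 (a) (9.17), chunk p0030] -/
private theorem step_half {l₁ l₂ l₃ a b c : ℤ} (h₁₂ : l₂ < l₁) (h₂₃ : l₃ < l₂) (hc : 0 ≤ c ∧ 2 * c ≤ l₂ - l₃)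
    (hB : 0 ≤ b * (l₁ - l₂) + a * c ∧ 2 * (b * (l₁ - l₂) + a * c) ≤ (l₁ - l₂) * (l₁ - l₃))
    (ha : 0 ≤ a ∧ a < l₁ - l₂)
    (h4 : (c = 0 ∨ b * (l₁ - l₂) + a * c = 0 ∨ 2 * (b * (l₁ - l₂) + a * c) = (l₁ - l₂) * (l₁ - l₃)) →
      2 * a ≤ l₁ - l₂) :
    ∃ a' b' : ℤ, ((0 ≤ c ∧ 2 * c ≤ l₂ - l₃) ∧
        (0 ≤ b' * (l₁ - l₂) + a' * c ∧ 2 * (b' * (l₁ - l₂) + a' * c) ≤ (l₁ - l₂) * (l₁ - l₃)) ∧ (0 ≤ a' ∧ a' < l₁ - l₂) ∧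
        ((c = 0 ∨ b' * (l₁ - l₂) + a' * c = 0 ∨ 2 * (b' * (l₁ - l₂) + a' * c) = (l₁ - l₂) * (l₁ - l₃)) → 2 * a' ≤ l₁ - l₂) ∧
        (2 * c = l₂ - l₃ → b' * (l₁ - l₂) + a' * c = 0 → (a' = 0 ∨ 2 * a' = l₁ - l₂)) ∧
        (2 * c = l₂ - l₃ → 2 * (b' * (l₁ - l₂) + a' * c) = (l₁ - l₂) * (l₁ - l₃) → 2 * a' < l₁ - l₂) ∧
        (2 * c = l₂ - l₃ → 0 < b' * (l₁ - l₂) + a' * c → 2 * (b' * (l₁ - l₂) + a' * c) < (l₁ - l₂) * (l₁ - l₃) →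
          a' * (l₁ - l₃) ≤ 2 * (b' * (l₁ - l₂) + a' * c))) ∧
      ∃ P : Matrix (Fin 3) (Fin 3) ℤ, IsUnit P.det ∧
        P * !![l₁, a, b; 0, l₂, c; 0, 0, l₃] = !![l₁, a', b'; 0, l₂, c; 0, 0, l₃] * P := by
  have hm0 : 0 < (l₁ - l₂) * (l₁ - l₃) := mul_pos (by omega) (by omega)
  by_cases hhalf : 2 * c = l₂ - l₃
  · by_cases hB0 : b * (l₁ - l₂) + a * c = 0
    · by_cases hn : a = 0 ∨ 2 * a = l₁ - l₂
      · exact ⟨a, b, ⟨hc, hB, ha, h4, fun _ _ => hn, fun _ _ => by omega, fun _ _ _ => by omega⟩, conj_refl _⟩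
      · exact step_half₁ h₁₂ h₂₃ hc ha (h4 (Or.inr (Or.inl hB0))) hhalf hB0 hn
    · by_cases hB2 : 2 * (b * (l₁ - l₂) + a * c) = (l₁ - l₂) * (l₁ - l₃)
      · by_cases h2a : 2 * a = l₁ - l₂
        · exact step_half₂ h₁₂ h₂₃ hc ha hhalf hB2 h2a
        · exact ⟨a, b, ⟨hc, hB, ha, h4, fun _ h => absurd h hB0, fun _ _ => by omega, fun _ _ _ => by omega⟩,
            conj_refl _⟩
      · by_cases h7 : a * (l₁ - l₃) ≤ 2 * (b * (l₁ - l₂) + a * c)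
        · exact ⟨a, b, ⟨hc, hB, ha, h4, fun _ h => absurd h hB0, fun _ h => absurd h hB2, fun _ _ _ => h7⟩,
            conj_refl _⟩
        · exact step_half₃ h₁₂ h₂₃ hc ha hhalf (by omega) (by omega) (by omega)
  · exact ⟨a, b, ⟨hc, hB, ha, h4, fun h => absurd h hhalf, fun h => absurd h hhalf, fun h => absurd h hhalf⟩,
      conj_refl _⟩

/-- **Normal form for the triangular forms (existence)**: for `λ₁ > λ₂ > λ₃` every `(λ₁ a b; 0 λ₂ c; 0 0 λ₃)` is
`GL₃(ℤ)`-conjugate to one satisfying the (corrected) conditions (9.17) — see the module docstring for the dictionary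
`δ₁ = a/(λ₁−λ₂)`, `δ₂ = c/(λ₂−λ₃)`, `δ₃ = (b(λ₁−λ₂) + ac)/((λ₁−λ₂)(λ₁−λ₃))`. [cite: HertlingLarabi2026b, §9.3 Lemma 9.6 (a), chunk p0030] -/
theorem exists_conj_normalForm_of_form {l₁ l₂ l₃ : ℤ} (h₁₂ : l₂ < l₁) (h₂₃ : l₃ < l₂) (a₀ b₀ c₀ : ℤ) :
    ∃ a b c : ℤ, ((0 ≤ c ∧ 2 * c ≤ l₂ - l₃) ∧
        (0 ≤ b * (l₁ - l₂) + a * c ∧ 2 * (b * (l₁ - l₂) + a * c) ≤ (l₁ - l₂) * (l₁ - l₃)) ∧ (0 ≤ a ∧ a < l₁ - l₂) ∧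
        ((c = 0 ∨ b * (l₁ - l₂) + a * c = 0 ∨ 2 * (b * (l₁ - l₂) + a * c) = (l₁ - l₂) * (l₁ - l₃)) → 2 * a ≤ l₁ - l₂) ∧
        (2 * c = l₂ - l₃ → b * (l₁ - l₂) + a * c = 0 → (a = 0 ∨ 2 * a = l₁ - l₂)) ∧
        (2 * c = l₂ - l₃ → 2 * (b * (l₁ - l₂) + a * c) = (l₁ - l₂) * (l₁ - l₃) → 2 * a < l₁ - l₂) ∧
        (2 * c = l₂ - l₃ → 0 < b * (l₁ - l₂) + a * c → 2 * (b * (l₁ - l₂) + a * c) < (l₁ - l₂) * (l₁ - l₃) →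
          a * (l₁ - l₃) ≤ 2 * (b * (l₁ - l₂) + a * c))) ∧
      ∃ P : Matrix (Fin 3) (Fin 3) ℤ, IsUnit P.det ∧
        P * !![l₁, a₀, b₀; 0, l₂, c₀; 0, 0, l₃] = !![l₁, a, b; 0, l₂, c; 0, 0, l₃] * P := by
  obtain ⟨a₁, b₁, c, hc, hj₁⟩ := step_c l₁ a₀ b₀ c₀ h₂₃
  obtain ⟨a₂, b₂, hB₂, hj₂⟩ := step_B a₁ b₁ c h₁₂ h₂₃
  obtain ⟨a₃, b₃, ha₃, hBe₃, hj₃⟩ := step_a l₃ a₂ b₂ c h₁₂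
  rw [← hBe₃] at hB₂
  obtain ⟨a₄, b₄, ha₄, hBe₄, h4, hj₄⟩ := step_N4 l₃ b₃ c ha₃
  rw [← hBe₄] at hB₂
  obtain ⟨a, b, hnf, hj₅⟩ := step_half h₁₂ h₂₃ hc hB₂ ha₄ h4
  exact ⟨a, b, c, hnf, conj_trans hj₁ (conj_trans hj₂ (conj_trans hj₃ (conj_trans hj₄ hj₅)))⟩

/-- **LEMMA 9.6 (a), matrix form — existence** (Remarks 9.7 (iii): «Lemma 9.6 (a) offers a unique matrix `M` in the
conjugacy class»): every integer `3 × 3` matrix with characteristic polynomial `(t − λ₁)(t − λ₂)(t − λ₃)`,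
`λ₁ > λ₂ > λ₃` integers, is `GL₃(ℤ)`-conjugate to a normal form `(λ₁ a b; 0 λ₂ c; 0 0 λ₃)` (conditions (N1)–(N7) of the
module docstring = (9.17) corrected). [cite: HertlingLarabi2026b, §9.3 Lemma 9.6 (a) and Remarks 9.7 (iii), chunks p0030–p0031] -/
theorem exists_conj_normalForm {l₁ l₂ l₃ : ℤ} {N : Matrix (Fin 3) (Fin 3) ℤ} (h₁₂ : l₂ < l₁) (h₂₃ : l₃ < l₂)
    (hχ : N.charpoly = (X - C l₁) * (X - C l₂) * (X - C l₃)) :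
    ∃ a b c : ℤ, ((0 ≤ c ∧ 2 * c ≤ l₂ - l₃) ∧
        (0 ≤ b * (l₁ - l₂) + a * c ∧ 2 * (b * (l₁ - l₂) + a * c) ≤ (l₁ - l₂) * (l₁ - l₃)) ∧ (0 ≤ a ∧ a < l₁ - l₂) ∧
        ((c = 0 ∨ b * (l₁ - l₂) + a * c = 0 ∨ 2 * (b * (l₁ - l₂) + a * c) = (l₁ - l₂) * (l₁ - l₃)) → 2 * a ≤ l₁ - l₂) ∧
        (2 * c = l₂ - l₃ → b * (l₁ - l₂) + a * c = 0 → (a = 0 ∨ 2 * a = l₁ - l₂)) ∧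
        (2 * c = l₂ - l₃ → 2 * (b * (l₁ - l₂) + a * c) = (l₁ - l₂) * (l₁ - l₃) → 2 * a < l₁ - l₂) ∧
        (2 * c = l₂ - l₃ → 0 < b * (l₁ - l₂) + a * c → 2 * (b * (l₁ - l₂) + a * c) < (l₁ - l₂) * (l₁ - l₃) →
          a * (l₁ - l₃) ≤ 2 * (b * (l₁ - l₂) + a * c))) ∧
      ∃ P : Matrix (Fin 3) (Fin 3) ℤ, IsUnit P.det ∧ P * N = !![l₁, a, b; 0, l₂, c; 0, 0, l₃] * P := by
  obtain ⟨a₀, b₀, c₀, P, hP, hPN⟩ := exists_conj_upperTriangular hχ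
  obtain ⟨a, b, c, hnf, hj⟩ := exists_conj_normalForm_of_form h₁₂ h₂₃ a₀ b₀ c₀
  exact ⟨a, b, c, hnf, conj_trans ⟨P, hP, hPN⟩ hj⟩


/-! ## §4 Uniqueness of the normal form («The `ℤ`-basis is unique») -/

/-- `−d < kd < d ⟹ k = 0` (`d ≥ 1`). [folklore] -/
private theorem eq_zero_of_mul_lt {d k : ℤ} (hd : 0 < d) (h1 : -d < k * d) (h2 : k * d < d) : k = 0 := by
  have hk1 : k < 1 := lt_of_mul_lt_mul_right (by linarith : k * d < 1 * d) hd.le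
  have hk2 : -1 < k := lt_of_mul_lt_mul_right (by linarith : -1 * d < k * d) hd.le
  omega

/-- `−2d < kd < 2d ⟹ k ∈ {−1, 0, 1}` (`d ≥ 1`). [folklore] -/
private theorem mem_of_mul_lt {d k : ℤ} (hd : 0 < d) (h1 : -(2 * d) < k * d) (h2 : k * d < 2 * d) :
    k = -1 ∨ k = 0 ∨ k = 1 := by
  have hk1 : k < 2 := lt_of_mul_lt_mul_right (by linarith : k * d < 2 * d) hd.le
  have hk2 : -2 < k := lt_of_mul_lt_mul_right (by linarith : -2 * d < k * d) hd.le
  omega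

/-- The configuration behind the correction of (9.17): two normal forms with `δ₂ = ½`, `δ₁ + δ₁′ = 1`,
`δ₁, δ₁′ > 0` and `δ₃′ = δ₃ + δ₁′` do not exist (linear bookkeeping; `ad := a(λ₁−λ₃)`, `a′d := a′(λ₁−λ₃)`,
`M := (λ₁−λ₂)(λ₁−λ₃)`). [cite: HertlingLarabi2026b, §9.3 Lemma 9.6 (a) (9.17), chunk p0030] -/
private theorem key₁ {a a' B B' d₁ M ad a'd : ℤ} (ha : 0 < a) (had' : 0 < a'd) (hs : ad + a'd = M)
    (haa : a + a' = d₁) (hah' : 2 * a' = d₁ → 2 * a'd = M) (hB : 0 ≤ B) (hB' : 2 * B' ≤ M)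
    (h5 : B = 0 → (a = 0 ∨ 2 * a = d₁)) (h6' : 2 * B' = M → 2 * a' < d₁) (h7 : 0 < B → 2 * B < M → ad ≤ 2 * B)
    (hBB : B' = B + a'd) : False := by
  omega

/-- Two normal forms with the same `δ₁`, `δ₂ = ½` and `δ₃ + δ₃′ = δ₁` coincide (`ad := a(λ₁−λ₃)`,
`M := (λ₁−λ₂)(λ₁−λ₃)`). [cite: HertlingLarabi2026b, §9.3 Lemma 9.6 (a) (9.17), chunk p0030] -/
private theorem key₂ {a B B' d₁ M ad : ℤ} (had0 : 0 ≤ ad) (haz : a = 0 → ad = 0)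
    (hah : 2 * a = d₁ → 2 * ad = M) (hal : 2 * a < d₁ → 2 * ad < M) (hB : 0 ≤ B ∧ 2 * B ≤ M)
    (hB' : 0 ≤ B' ∧ 2 * B' ≤ M) (h5 : B = 0 → (a = 0 ∨ 2 * a = d₁)) (h6 : 2 * B = M → 2 * a < d₁)
    (h7 : 0 < B → 2 * B < M → ad ≤ 2 * B) (h5' : B' = 0 → (a = 0 ∨ 2 * a = d₁))
    (h6' : 2 * B' = M → 2 * a < d₁) (h7' : 0 < B' → 2 * B' < M → ad ≤ 2 * B') (hBB : B + B' = ad) :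
    B = B' := by
  omega

/-- Sign pattern `(ε₁, ε₂, ε₃) = (1, 1, 1)` of the conjugator: the entry equations are differences, the windows of
length `< d` force `x = z = y = 0`. (`ad′ := a′(λ₁ − λ₃)`, `M := (λ₁ − λ₂)(λ₁ − λ₃)`, `B := b(λ₁ − λ₂) + ac`.)
[cite: HertlingLarabi2026b, §9.3 Lemma 9.6 (a), chunk p0030] -/
private theorem unique_case₁ {a a' c c' B B' d₁ d₂ M ad' x y z : ℤ} (hd₁ : 0 < d₁) (hd₂ : 0 < d₂) (hM : 0 < M)
    (ha : 0 ≤ a ∧ a < d₁) (ha' : 0 ≤ a' ∧ a' < d₁) (hc : 0 ≤ c ∧ 2 * c ≤ d₂) (hc' : 0 ≤ c' ∧ 2 * c' ≤ d₂)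
    (hB : 0 ≤ B ∧ 2 * B ≤ M) (hB' : 0 ≤ B' ∧ 2 * B' ≤ M)
    (e1 : a' = a - x * d₁) (e2 : c' = c - z * d₂) (bI : B' = B - z * ad' - y * M) :
    a = a' ∧ c = c' ∧ B = B' := by
  obtain rfl := eq_zero_of_mul_lt hd₁ (k := x) (by linarith [ha.1, ha'.2]) (by linarith [ha.2, ha'.1])
  obtain rfl := eq_zero_of_mul_lt hd₂ (k := z) (by linarith [hc.1, hc'.2]) (by linarith [hc.2, hc'.1])
  rw [zero_mul, sub_zero] at bI
  obtain rfl := eq_zero_of_mul_lt hM (k := y) (by linarith [hB.1, hB'.2]) (by linarith [hB.2, hB'.1])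
  omega

/-- Sign pattern `(1, 1, −1)`: `a′ = a`; `c + c′ ∈ d₂ℤ` forces `c = c′ ∈ {0, d₂/2}`; for `c = 0`, `B + B′ ∈ Mℤ` forces
`B = B′`; for `2c = d₂`, `B + B′ ≡ a(λ₁ − λ₃) (mod M)` and the conditions for `δ₂ = ½` force `B = B′` (`key₂`).
[cite: HertlingLarabi2026b, §9.3 Lemma 9.6 (a), chunk p0030] -/
private theorem unique_case₂ {a a' c c' B B' d₁ d₂ M ad ad' x y z : ℤ} (hd₁ : 0 < d₁) (hd₂ : 0 < d₂) (hM : 0 < M)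
    (ha : 0 ≤ a ∧ a < d₁) (ha' : 0 ≤ a' ∧ a' < d₁) (hc : 0 ≤ c ∧ 2 * c ≤ d₂) (hc' : 0 ≤ c' ∧ 2 * c' ≤ d₂)
    (hB : 0 ≤ B ∧ 2 * B ≤ M) (hB' : 0 ≤ B' ∧ 2 * B' ≤ M)
    (had0 : 0 ≤ ad) (hadm' : ad' < M) (haa : a = a' → ad = ad') (haz : a = 0 → ad = 0)
    (hah : 2 * a = d₁ → 2 * ad = M) (hal : 2 * a < d₁ → 2 * ad < M)
    (h5 : 2 * c = d₂ → B = 0 → (a = 0 ∨ 2 * a = d₁)) (h6 : 2 * c = d₂ → 2 * B = M → 2 * a < d₁)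
    (h7 : 2 * c = d₂ → 0 < B → 2 * B < M → ad ≤ 2 * B)
    (h5' : 2 * c' = d₂ → B' = 0 → (a' = 0 ∨ 2 * a' = d₁)) (h6' : 2 * c' = d₂ → 2 * B' = M → 2 * a' < d₁)
    (h7' : 2 * c' = d₂ → 0 < B' → 2 * B' < M → ad' ≤ 2 * B')
    (e1 : a' = a - x * d₁) (e2 : c + c' = z * d₂) (bI : B + B' = z * ad' + y * M) :
    a = a' ∧ c = c' ∧ B = B' := by
  obtain rfl := eq_zero_of_mul_lt hd₁ (k := x) (by linarith [ha.1, ha'.2]) (by linarith [ha.2, ha'.1])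
  rw [zero_mul, sub_zero] at e1
  subst e1
  obtain rfl := haa rfl
  rcases mem_of_mul_lt hd₂ (k := z) (by linarith [hc.1, hc'.1]) (by linarith [hc.2, hc'.2]) with rfl | rfl | rfl
  · exfalso; linarith [hc.1, hc'.1]
  · rw [zero_mul] at e2
    rw [zero_mul, zero_add] at bI
    clear h5 h6 h7 h5' h6' h7' haz hah hal
    rcases mem_of_mul_lt hM (k := y) (by linarith [hB.1, hB'.1]) (by linarith [hB.2, hB'.2]) with rfl | rfl | rfl
      <;> omega
  · rw [one_mul] at e2 bI
    have hcd : 2 * c = d₂ := by linarith [hc.2, hc'.2]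
    have hcd' : 2 * c' = d₂ := by linarith [hc.2, hc'.2]
    specialize h5 hcd
    specialize h6 hcd
    specialize h7 hcd
    specialize h5' hcd'
    specialize h6' hcd'
    specialize h7' hcd'
    rcases mem_of_mul_lt hM (k := y) (by linarith [hB.1, hB'.1]) (by linarith [hB.2, hB'.2]) with rfl | rfl | rfl
    · exfalso; linarith [hB.1, hB'.1]
    · rw [zero_mul, add_zero] at bI
      exact ⟨rfl, by linarith, key₂ had0 haz hah hal hB hB' h5 h6 h7 h5' h6' h7' bI⟩
    · clear h5 h6 h7 h5' h6' h7' hah hal haz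
      omega

/-- Sign pattern `(1, −1, 1)`: `a + a′ ∈ d₁ℤ`, `c + c′ ∈ d₂ℤ`; for `c = 0` (N4) forces `a = a′`; for `2c = d₂` and
`a + a′ = d₁` one gets `B′ − B ≡ a′(λ₁ − λ₃) (mod M)`, which the conditions for `δ₂ = ½` exclude (`key₁`).
[cite: HertlingLarabi2026b, §9.3 Lemma 9.6 (a), chunk p0030] -/
private theorem unique_case₃ {a a' c c' B B' d₁ d₂ M ad ad' x y z : ℤ} (hd₁ : 0 < d₁) (hd₂ : 0 < d₂) (hM : 0 < M)
    (ha : 0 ≤ a ∧ a < d₁) (ha' : 0 ≤ a' ∧ a' < d₁) (hc : 0 ≤ c ∧ 2 * c ≤ d₂) (hc' : 0 ≤ c' ∧ 2 * c' ≤ d₂)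
    (hB : 0 ≤ B ∧ 2 * B ≤ M) (hB' : 0 ≤ B' ∧ 2 * B' ≤ M)
    (haz' : a' = 0 → ad' = 0) (hap : 0 < a → 0 < ad) (hap' : 0 < a' → 0 < ad')
    (hah : 2 * a = d₁ → 2 * ad = M) (hah' : 2 * a' = d₁ → 2 * ad' = M) (hsum : a + a' = d₁ → ad + ad' = M)
    (h4 : (c = 0 ∨ B = 0 ∨ 2 * B = M) → 2 * a ≤ d₁) (h4' : (c' = 0 ∨ B' = 0 ∨ 2 * B' = M) → 2 * a' ≤ d₁)
    (h5 : 2 * c = d₂ → B = 0 → (a = 0 ∨ 2 * a = d₁)) (h6 : 2 * c = d₂ → 2 * B = M → 2 * a < d₁)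
    (h7 : 2 * c = d₂ → 0 < B → 2 * B < M → ad ≤ 2 * B)
    (h5' : 2 * c' = d₂ → B' = 0 → (a' = 0 ∨ 2 * a' = d₁)) (h6' : 2 * c' = d₂ → 2 * B' = M → 2 * a' < d₁)
    (h7' : 2 * c' = d₂ → 0 < B' → 2 * B' < M → ad' ≤ 2 * B')
    (e1 : a + a' = x * d₁) (e2 : c + c' + z * d₂ = 0) (bI : B' = B - z * ad' - y * M) :
    a = a' ∧ c = c' ∧ B = B' := by
  rcases mem_of_mul_lt hd₂ (k := z) (by linarith [hc.2, hc'.2]) (by linarith [hc.1, hc'.1]) with rfl | rfl | rfl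
  · -- `z = −1`: `2c = 2c′ = d₂`
    rw [neg_one_mul] at e2
    rw [neg_one_mul, sub_neg_eq_add] at bI
    have hcd : 2 * c = d₂ := by linarith [hc.2, hc'.2]
    have hcd' : 2 * c' = d₂ := by linarith [hc.2, hc'.2]
    specialize h5 hcd
    specialize h6 hcd
    specialize h7 hcd
    specialize h5' hcd'
    specialize h6' hcd'
    specialize h7' hcd'
    clear h4 h4'
    rcases mem_of_mul_lt hd₁ (k := x) (by linarith [ha.1, ha'.1]) (by linarith [ha.2, ha'.2]) with rfl | rfl | rfl
    · exfalso; linarith [ha.1, ha'.1]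
    · -- `x = 0`: `a = a′ = 0`
      rw [zero_mul] at e1
      have ha0' : a' = 0 := by linarith [ha.1, ha'.1]
      rw [haz' ha0', add_zero] at bI
      obtain rfl := eq_zero_of_mul_lt hM (k := y) (by linarith [hB.2, hB'.1]) (by linarith [hB.1, hB'.2])
      clear h5 h6 h7 h5' h6' h7' hah hah' hsum hap hap' haz'
      omega
    · -- `x = 1`: `a + a′ = d₁`, `a, a′ > 0`
      rw [one_mul] at e1
      have had : 0 < ad := hap (by linarith [ha'.2])
      have had' : 0 < ad' := hap' (by linarith [ha.2])
      have hs := hsum e1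
      rcases mem_of_mul_lt hM (k := y) (by linarith [hB.2, hB'.1]) (by linarith [hB.1, hB'.2]) with rfl | rfl | rfl
      · exfalso; linarith [hB.1, hB'.2]
      · rw [zero_mul, sub_zero] at bI
        exact (key₁ (by linarith [ha'.2]) had' hs e1 hah' hB.1 hB'.2 h5 h6' h7 bI).elim
      · rw [one_mul] at bI
        exact (key₁ (by linarith [ha.2]) had (by linarith [hs]) (by linarith [e1]) hah hB'.1 hB.2 h5' h6 h7'
          (by linarith [bI, hs])).elim
  · -- `z = 0`: `c = c′ = 0`
    rw [zero_mul, add_zero] at e2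
    rw [zero_mul, sub_zero] at bI
    have hc0 : c = 0 := by linarith [hc.1, hc'.1]
    have hc0' : c' = 0 := by linarith [hc.1, hc'.1]
    have h2a := h4 (Or.inl hc0)
    have h2a' := h4' (Or.inl hc0')
    clear h4 h4' h5 h6 h7 h5' h6' h7' hah hah' hsum hap hap' haz'
    obtain rfl := eq_zero_of_mul_lt hM (k := y) (by linarith [hB.2, hB'.1]) (by linarith [hB.1, hB'.2])
    rcases mem_of_mul_lt hd₁ (k := x) (by linarith [ha.1, ha'.1]) (by linarith [ha.2, ha'.2]) with rfl | rfl | rfl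
      <;> omega
  · exfalso; rw [one_mul] at e2; linarith [hc.1, hc'.1]

/-- Sign pattern `(1, −1, −1)`: `c′ − c ∈ d₂ℤ` forces `c = c′`, `B + B′ ∈ Mℤ` forces `B = B′ ∈ {0, M/2}`, and then
(N4) with `a + a′ ∈ d₁ℤ` forces `a = a′`. [cite: HertlingLarabi2026b, §9.3 Lemma 9.6 (a), chunk p0030] -/
private theorem unique_case₄ {a a' c c' B B' d₁ d₂ M ad' x y z : ℤ} (hd₁ : 0 < d₁) (hd₂ : 0 < d₂) (hM : 0 < M)
    (ha : 0 ≤ a ∧ a < d₁) (ha' : 0 ≤ a' ∧ a' < d₁) (hc : 0 ≤ c ∧ 2 * c ≤ d₂) (hc' : 0 ≤ c' ∧ 2 * c' ≤ d₂)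
    (hB : 0 ≤ B ∧ 2 * B ≤ M) (hB' : 0 ≤ B' ∧ 2 * B' ≤ M)
    (h4 : (c = 0 ∨ B = 0 ∨ 2 * B = M) → 2 * a ≤ d₁) (h4' : (c' = 0 ∨ B' = 0 ∨ 2 * B' = M) → 2 * a' ≤ d₁)
    (e1 : a + a' = x * d₁) (e2 : c' = c + z * d₂) (bI : B + B' = z * ad' + y * M) :
    a = a' ∧ c = c' ∧ B = B' := by
  obtain rfl := eq_zero_of_mul_lt hd₂ (k := z) (by linarith [hc.2, hc'.1]) (by linarith [hc.1, hc'.2])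
  rw [zero_mul, zero_add] at bI
  rcases mem_of_mul_lt hM (k := y) (by linarith [hB.1, hB'.1]) (by linarith [hB.2, hB'.2]) with rfl | rfl | rfl
  · exfalso; linarith [hB.1, hB'.1]
  · rcases mem_of_mul_lt hd₁ (k := x) (by linarith [ha.1, ha'.1]) (by linarith [ha.2, ha'.2]) with rfl | rfl | rfl
      <;> omega
  · rcases mem_of_mul_lt hd₁ (k := x) (by linarith [ha.1, ha'.1]) (by linarith [ha.2, ha'.2]) with rfl | rfl | rfl
      <;> omega

/-- **LEMMA 9.6 (a), matrix form — uniqueness** («Each `ε`-class of full lattices in `A` contains a unique full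
lattice with a `ℤ`-basis (9.16) and (9.17) […] The `ℤ`-basis is unique», for the corrected (9.17)): two normal forms
`(λ₁ a b; 0 λ₂ c; 0 0 λ₃)`, `(λ₁ a′ b′; 0 λ₂ c′; 0 0 λ₃)` which are `GL₃(ℤ)`-conjugate are EQUAL.  Proof: a conjugator is
upper triangular with diagonal signs `(ε₁, ε₂, ε₃)` (§1), w.l.o.g. `ε₁ = 1`; the entry equations say
`a′ ≡ ε₁ε₂a (mod λ₁−λ₂)`, `c′ ≡ ε₂ε₃c (mod λ₂−λ₃)`, `B′ ≡ ε₁ε₃B − ε₃z·a′(λ₁−λ₃) (mod (λ₁−λ₂)(λ₁−λ₃))` with `z = P₁₂`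
(`bInv_eq_of_conj`), and the windows (N1)–(N7) leave only the identity (the four sign patterns `unique_case₁…₄`).
[cite: HertlingLarabi2026b, §9.3 Lemma 9.6 (a), chunk p0030] -/
theorem normalForm_unique {l₁ l₂ l₃ a b c a' b' c' : ℤ} (h₁₂ : l₂ < l₁) (h₂₃ : l₃ < l₂)
    (hn : (0 ≤ c ∧ 2 * c ≤ l₂ - l₃) ∧
        (0 ≤ b * (l₁ - l₂) + a * c ∧ 2 * (b * (l₁ - l₂) + a * c) ≤ (l₁ - l₂) * (l₁ - l₃)) ∧ (0 ≤ a ∧ a < l₁ - l₂) ∧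
        ((c = 0 ∨ b * (l₁ - l₂) + a * c = 0 ∨ 2 * (b * (l₁ - l₂) + a * c) = (l₁ - l₂) * (l₁ - l₃)) → 2 * a ≤ l₁ - l₂) ∧
        (2 * c = l₂ - l₃ → b * (l₁ - l₂) + a * c = 0 → (a = 0 ∨ 2 * a = l₁ - l₂)) ∧
        (2 * c = l₂ - l₃ → 2 * (b * (l₁ - l₂) + a * c) = (l₁ - l₂) * (l₁ - l₃) → 2 * a < l₁ - l₂) ∧
        (2 * c = l₂ - l₃ → 0 < b * (l₁ - l₂) + a * c → 2 * (b * (l₁ - l₂) + a * c) < (l₁ - l₂) * (l₁ - l₃) →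
          a * (l₁ - l₃) ≤ 2 * (b * (l₁ - l₂) + a * c)))
    (hn' : (0 ≤ c' ∧ 2 * c' ≤ l₂ - l₃) ∧
        (0 ≤ b' * (l₁ - l₂) + a' * c' ∧ 2 * (b' * (l₁ - l₂) + a' * c') ≤ (l₁ - l₂) * (l₁ - l₃)) ∧ (0 ≤ a' ∧ a' < l₁ - l₂) ∧
        ((c' = 0 ∨ b' * (l₁ - l₂) + a' * c' = 0 ∨ 2 * (b' * (l₁ - l₂) + a' * c') = (l₁ - l₂) * (l₁ - l₃)) → 2 * a' ≤ l₁ - l₂) ∧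
        (2 * c' = l₂ - l₃ → b' * (l₁ - l₂) + a' * c' = 0 → (a' = 0 ∨ 2 * a' = l₁ - l₂)) ∧
        (2 * c' = l₂ - l₃ → 2 * (b' * (l₁ - l₂) + a' * c') = (l₁ - l₂) * (l₁ - l₃) → 2 * a' < l₁ - l₂) ∧
        (2 * c' = l₂ - l₃ → 0 < b' * (l₁ - l₂) + a' * c' → 2 * (b' * (l₁ - l₂) + a' * c') < (l₁ - l₂) * (l₁ - l₃) →
          a' * (l₁ - l₃) ≤ 2 * (b' * (l₁ - l₂) + a' * c')))
    (hconj : ∃ P : Matrix (Fin 3) (Fin 3) ℤ, IsUnit P.det ∧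
      P * !![l₁, a, b; 0, l₂, c; 0, 0, l₃] = !![l₁, a', b'; 0, l₂, c'; 0, 0, l₃] * P) :
    a = a' ∧ b = b' ∧ c = c' := by
  have n₁₂ : l₁ ≠ l₂ := by omega
  have n₂₃ : l₂ ≠ l₃ := by omega
  have n₁₃ : l₁ ≠ l₃ := by omega
  have hd₁ : 0 < l₁ - l₂ := by omega
  have hd₂ : 0 < l₂ - l₃ := by omega
  have hd₃ : 0 < l₁ - l₃ := by omega
  -- it suffices to treat conjugators with `P₀₀ = 1` (replace `P` by `−P`)
  suffices key : ∀ P : Matrix (Fin 3) (Fin 3) ℤ, IsUnit P.det →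
      P * !![l₁, a, b; 0, l₂, c; 0, 0, l₃] = !![l₁, a', b'; 0, l₂, c'; 0, 0, l₃] * P → P 0 0 = 1 →
      a = a' ∧ b = b' ∧ c = c' by
    obtain ⟨P, hP, h⟩ := hconj
    obtain ⟨u0, -, -⟩ := diag_mul_self_eq_one_of_conj n₁₂ n₂₃ n₁₃ hP h
    rcases Int.eq_one_or_neg_one_of_mul_eq_one' u0 with ⟨h0, -⟩ | ⟨h0, -⟩
    · exact key P hP h h0
    · refine key (-P) ?_ ?_ ?_
      · rw [Matrix.det_neg]; exact ((isUnit_one.neg).pow _).mul hP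
      · rw [Matrix.neg_mul, Matrix.mul_neg, h]
      · rw [Matrix.neg_apply, h0, neg_neg]
  intro P hP h h00
  obtain ⟨-, -, -, e1, e2, -⟩ := upper_of_conj n₁₂ n₂₃ n₁₃ h
  obtain ⟨-, u1, u2⟩ := diag_mul_self_eq_one_of_conj n₁₂ n₂₃ n₁₃ hP h
  have bI := bInv_eq_of_conj n₁₂ n₂₃ n₁₃ hP h
  rw [h00] at e1 bI
  obtain ⟨hc, hB, ha, h4, h5, h6, h7⟩ := hn
  obtain ⟨hc', hB', ha', h4', h5', h6', h7'⟩ := hn'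
  -- the conclusion, from `a = a′`, `c = c′`, `B = B′`
  have fin : a = a' ∧ c = c' ∧ b * (l₁ - l₂) + a * c = b' * (l₁ - l₂) + a' * c' → a = a' ∧ b = b' ∧ c = c' := by
    rintro ⟨ha, hc, hB⟩
    refine ⟨ha, ?_, hc⟩
    rw [ha, hc] at hB
    exact mul_right_cancel₀ hd₁.ne' (by linarith)
  -- the monotone dictionary `a ↦ a(λ₁ − λ₃)` (the only nonlinear input)
  have hM : 0 < (l₁ - l₂) * (l₁ - l₃) := mul_pos hd₁ hd₃
  have had0 : 0 ≤ a * (l₁ - l₃) := mul_nonneg ha.1 hd₃.le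
  have hadm' : a' * (l₁ - l₃) < (l₁ - l₂) * (l₁ - l₃) := mul_lt_mul_of_pos_right ha'.2 hd₃
  have haa : a = a' → a * (l₁ - l₃) = a' * (l₁ - l₃) := fun h => by rw [h]
  have haz : a = 0 → a * (l₁ - l₃) = 0 := fun h => by rw [h, zero_mul]
  have haz' : a' = 0 → a' * (l₁ - l₃) = 0 := fun h => by rw [h, zero_mul]
  have hap : 0 < a → 0 < a * (l₁ - l₃) := fun h => mul_pos h hd₃
  have hap' : 0 < a' → 0 < a' * (l₁ - l₃) := fun h => mul_pos h hd₃
  have hah : 2 * a = l₁ - l₂ → 2 * (a * (l₁ - l₃)) = (l₁ - l₂) * (l₁ - l₃) := fun h => by rw [← h, mul_assoc]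
  have hah' : 2 * a' = l₁ - l₂ → 2 * (a' * (l₁ - l₃)) = (l₁ - l₂) * (l₁ - l₃) := fun h => by
    rw [← h, mul_assoc]
  have hal : 2 * a < l₁ - l₂ → 2 * (a * (l₁ - l₃)) < (l₁ - l₂) * (l₁ - l₃) := fun h => by
    rw [← mul_assoc]; exact mul_lt_mul_of_pos_right h hd₃
  have hsum : a + a' = l₁ - l₂ → a * (l₁ - l₃) + a' * (l₁ - l₃) = (l₁ - l₂) * (l₁ - l₃) := fun h => by
    rw [← add_mul, h]
  -- the four sign patterns `(1, ε₂, ε₃)`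
  rcases Int.eq_one_or_neg_one_of_mul_eq_one' u1 with ⟨q, -⟩ | ⟨q, -⟩ <;>
    rcases Int.eq_one_or_neg_one_of_mul_eq_one' u2 with ⟨r, -⟩ | ⟨r, -⟩ <;> rw [q] at e1 e2 <;> rw [r] at e2 bI
  · exact fin (unique_case₁ (ad' := a' * (l₁ - l₃)) (x := P 0 1) (y := P 0 2) (z := P 1 2) hd₁ hd₂ hM ha ha' hc
      hc' hB hB' (by linear_combination e1) (by linear_combination e2) (by linear_combination bI))
  · exact fin (unique_case₂ (x := P 0 1) (y := P 0 2) (z := P 1 2) hd₁ hd₂ hM ha ha' hc hc' hB hB' had0 hadm'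
      haa haz hah hal h5 h6 h7 h5' h6' h7' (by linear_combination e1) (by linear_combination -e2)
      (by linear_combination bI))
  · exact fin (unique_case₃ (x := P 0 1) (y := P 0 2) (z := P 1 2) hd₁ hd₂ hM ha ha' hc hc' hB hB' haz' hap
      hap' hah hah' hsum h4 h4' h5 h6 h7 h5' h6' h7' (by linear_combination -e1) (by linear_combination e2)
      (by linear_combination bI))
  · exact fin (unique_case₄ (ad' := a' * (l₁ - l₃)) (x := P 0 1) (y := P 0 2) (z := P 1 2) hd₁ hd₂ hM ha ha' hc
      hc' hB hB' h4 h4' (by linear_combination -e1) (by linear_combination -e2) (by linear_combination bI))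


/-! ## §5 The classification: `∃!`, the bijection with the explicit finite set of triples, (9.17) as a case list -/

/-- **LEMMA 9.6 (a) / REMARKS 9.7 (iii), matrix form**: for integers `λ₁ > λ₂ > λ₃`, every integer `3 × 3` matrix `N`
with `χ_N = (t − λ₁)(t − λ₂)(t − λ₃)` is `GL₃(ℤ)`-conjugate to EXACTLY ONE normal form `(λ₁ a b; 0 λ₂ c; 0 0 λ₃)`,
(N1)–(N7) («Lemma 9.6 (a) offers a unique matrix `M` in the conjugacy class via `(λ₁e₁ + λ₂e₂ + λ₃e₃)·eD = eD·M`»;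
with (9.17) corrected as in the module docstring). [cite: HertlingLarabi2026b, §9.3 Lemma 9.6 (a) and Remarks 9.7 (iii), chunks p0030–p0031] -/
theorem existsUnique_conj_normalForm {l₁ l₂ l₃ : ℤ} {N : Matrix (Fin 3) (Fin 3) ℤ} (h₁₂ : l₂ < l₁) (h₂₃ : l₃ < l₂)
    (hχ : N.charpoly = (X - C l₁) * (X - C l₂) * (X - C l₃)) :
    ∃! t : ℤ × ℤ × ℤ, ((0 ≤ t.2.2 ∧ 2 * t.2.2 ≤ l₂ - l₃) ∧
          (0 ≤ t.2.1 * (l₁ - l₂) + t.1 * t.2.2 ∧ 2 * (t.2.1 * (l₁ - l₂) + t.1 * t.2.2) ≤ (l₁ - l₂) * (l₁ - l₃)) ∧ (0 ≤ t.1 ∧ t.1 < l₁ - l₂) ∧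
          ((t.2.2 = 0 ∨ t.2.1 * (l₁ - l₂) + t.1 * t.2.2 = 0 ∨ 2 * (t.2.1 * (l₁ - l₂) + t.1 * t.2.2) = (l₁ - l₂) * (l₁ - l₃)) → 2 * t.1 ≤ l₁ - l₂) ∧
          (2 * t.2.2 = l₂ - l₃ → t.2.1 * (l₁ - l₂) + t.1 * t.2.2 = 0 → (t.1 = 0 ∨ 2 * t.1 = l₁ - l₂)) ∧
          (2 * t.2.2 = l₂ - l₃ → 2 * (t.2.1 * (l₁ - l₂) + t.1 * t.2.2) = (l₁ - l₂) * (l₁ - l₃) → 2 * t.1 < l₁ - l₂) ∧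
          (2 * t.2.2 = l₂ - l₃ → 0 < t.2.1 * (l₁ - l₂) + t.1 * t.2.2 → 2 * (t.2.1 * (l₁ - l₂) + t.1 * t.2.2) < (l₁ - l₂) * (l₁ - l₃) →
            t.1 * (l₁ - l₃) ≤ 2 * (t.2.1 * (l₁ - l₂) + t.1 * t.2.2))) ∧
      ∃ P : Matrix (Fin 3) (Fin 3) ℤ, IsUnit P.det ∧ P * N = !![l₁, t.1, t.2.1; 0, l₂, t.2.2; 0, 0, l₃] * P := by
  obtain ⟨a, b, c, hnf, hconj⟩ := exists_conj_normalForm h₁₂ h₂₃ hχ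
  refine ⟨(a, b, c), ⟨hnf, hconj⟩, ?_⟩
  rintro ⟨a', b', c'⟩ ⟨hnf', hconj'⟩
  obtain ⟨e₁, e₂, e₃⟩ := normalForm_unique h₁₂ h₂₃ hnf' hnf (conj_trans (conj_symm hconj') hconj)
  subst e₁ e₂ e₃
  rfl

/-- **The classification as a BIJECTION** (Theorem 6.3's «1:1» composed with Lemma 9.6 (a)): for integers
`λ₁ > λ₂ > λ₃`, `[N]_ℤ ↦ (a, b, c)` is a bijection from the `GL₃(ℤ)`-conjugacy classes of integer `3 × 3` matrices with
`χ_N = (t − λ₁)(t − λ₂)(t − λ₃)` onto the explicit finite set of triples `(a, b, c) ∈ ℤ³` satisfying (N1)–(N7), with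
value `(a, b, c)` on the class of `(λ₁ a b; 0 λ₂ c; 0 0 λ₃)`. [cite: HertlingLarabi2026b, §6 Thm. 6.3 (chunk p0012) and §9.3 Lemma 9.6 (a), Rem. 9.7 (iii) (chunks p0030–p0031)] -/
theorem exists_bijective_quot_conj {l₁ l₂ l₃ : ℤ} (h₁₂ : l₂ < l₁) (h₂₃ : l₃ < l₂) :
    ∃ F : (Quot fun N N' : {N : Matrix (Fin 3) (Fin 3) ℤ //
          N.charpoly = (X - C l₁) * (X - C l₂) * (X - C l₃)} =>
        ∃ P : Matrix (Fin 3) (Fin 3) ℤ, IsUnit P.det ∧ P * N.1 = N'.1 * P) →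
      {t : ℤ × ℤ × ℤ // (0 ≤ t.2.2 ∧ 2 * t.2.2 ≤ l₂ - l₃) ∧
          (0 ≤ t.2.1 * (l₁ - l₂) + t.1 * t.2.2 ∧ 2 * (t.2.1 * (l₁ - l₂) + t.1 * t.2.2) ≤ (l₁ - l₂) * (l₁ - l₃)) ∧ (0 ≤ t.1 ∧ t.1 < l₁ - l₂) ∧
          ((t.2.2 = 0 ∨ t.2.1 * (l₁ - l₂) + t.1 * t.2.2 = 0 ∨ 2 * (t.2.1 * (l₁ - l₂) + t.1 * t.2.2) = (l₁ - l₂) * (l₁ - l₃)) → 2 * t.1 ≤ l₁ - l₂) ∧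
          (2 * t.2.2 = l₂ - l₃ → t.2.1 * (l₁ - l₂) + t.1 * t.2.2 = 0 → (t.1 = 0 ∨ 2 * t.1 = l₁ - l₂)) ∧
          (2 * t.2.2 = l₂ - l₃ → 2 * (t.2.1 * (l₁ - l₂) + t.1 * t.2.2) = (l₁ - l₂) * (l₁ - l₃) → 2 * t.1 < l₁ - l₂) ∧
          (2 * t.2.2 = l₂ - l₃ → 0 < t.2.1 * (l₁ - l₂) + t.1 * t.2.2 → 2 * (t.2.1 * (l₁ - l₂) + t.1 * t.2.2) < (l₁ - l₂) * (l₁ - l₃) →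
            t.1 * (l₁ - l₃) ≤ 2 * (t.2.1 * (l₁ - l₂) + t.1 * t.2.2))},
      Function.Bijective F ∧ ∀ (a b c : ℤ) (h : (0 ≤ c ∧ 2 * c ≤ l₂ - l₃) ∧
          (0 ≤ b * (l₁ - l₂) + a * c ∧ 2 * (b * (l₁ - l₂) + a * c) ≤ (l₁ - l₂) * (l₁ - l₃)) ∧ (0 ≤ a ∧ a < l₁ - l₂) ∧
          ((c = 0 ∨ b * (l₁ - l₂) + a * c = 0 ∨ 2 * (b * (l₁ - l₂) + a * c) = (l₁ - l₂) * (l₁ - l₃)) → 2 * a ≤ l₁ - l₂) ∧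
          (2 * c = l₂ - l₃ → b * (l₁ - l₂) + a * c = 0 → (a = 0 ∨ 2 * a = l₁ - l₂)) ∧
          (2 * c = l₂ - l₃ → 2 * (b * (l₁ - l₂) + a * c) = (l₁ - l₂) * (l₁ - l₃) → 2 * a < l₁ - l₂) ∧
          (2 * c = l₂ - l₃ → 0 < b * (l₁ - l₂) + a * c → 2 * (b * (l₁ - l₂) + a * c) < (l₁ - l₂) * (l₁ - l₃) →
            a * (l₁ - l₃) ≤ 2 * (b * (l₁ - l₂) + a * c))) (hN),
        F (Quot.mk _ ⟨!![l₁, a, b; 0, l₂, c; 0, 0, l₃], hN⟩) = ⟨(a, b, c), h⟩ := by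
  set S := {N : Matrix (Fin 3) (Fin 3) ℤ // N.charpoly = (X - C l₁) * (X - C l₂) * (X - C l₃)}
  set I := {t : ℤ × ℤ × ℤ // (0 ≤ t.2.2 ∧ 2 * t.2.2 ≤ l₂ - l₃) ∧
          (0 ≤ t.2.1 * (l₁ - l₂) + t.1 * t.2.2 ∧ 2 * (t.2.1 * (l₁ - l₂) + t.1 * t.2.2) ≤ (l₁ - l₂) * (l₁ - l₃)) ∧ (0 ≤ t.1 ∧ t.1 < l₁ - l₂) ∧
          ((t.2.2 = 0 ∨ t.2.1 * (l₁ - l₂) + t.1 * t.2.2 = 0 ∨ 2 * (t.2.1 * (l₁ - l₂) + t.1 * t.2.2) = (l₁ - l₂) * (l₁ - l₃)) → 2 * t.1 ≤ l₁ - l₂) ∧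
          (2 * t.2.2 = l₂ - l₃ → t.2.1 * (l₁ - l₂) + t.1 * t.2.2 = 0 → (t.1 = 0 ∨ 2 * t.1 = l₁ - l₂)) ∧
          (2 * t.2.2 = l₂ - l₃ → 2 * (t.2.1 * (l₁ - l₂) + t.1 * t.2.2) = (l₁ - l₂) * (l₁ - l₃) → 2 * t.1 < l₁ - l₂) ∧
          (2 * t.2.2 = l₂ - l₃ → 0 < t.2.1 * (l₁ - l₂) + t.1 * t.2.2 → 2 * (t.2.1 * (l₁ - l₂) + t.1 * t.2.2) < (l₁ - l₂) * (l₁ - l₃) →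
            t.1 * (l₁ - l₃) ≤ 2 * (t.2.1 * (l₁ - l₂) + t.1 * t.2.2))}
  set r : S → S → Prop := fun N N' => ∃ P : Matrix (Fin 3) (Fin 3) ℤ, IsUnit P.det ∧ P * N.1 = N'.1 * P
    with hr_def
  have hr : Equivalence r := equivalence_conj _
  set Nm : I → S := fun t => ⟨!![l₁, t.1.1, t.1.2.1; 0, l₂, t.1.2.2; 0, 0, l₃], charpoly_triangular _ _ _ _ _ _⟩
    with hNm_def
  have hex : ∀ N : S, ∃ t : I, r N (Nm t) := fun N => by
    obtain ⟨a, b, c, hnf, hconj⟩ := exists_conj_normalForm h₁₂ h₂₃ N.2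
    exact ⟨⟨(a, b, c), hnf⟩, hconj⟩
  choose f hf using hex
  have hU : ∀ t t' : I, r (Nm t) (Nm t') → t = t' := by
    rintro ⟨⟨a, b, c⟩, hnf⟩ ⟨⟨a', b', c'⟩, hnf'⟩ h
    obtain ⟨e₁, e₂, e₃⟩ := normalForm_unique h₁₂ h₂₃ hnf hnf' h
    subst e₁ e₂ e₃
    rfl
  have hwd : ∀ N N' : S, r N N' → f N = f N' := fun N N' h =>
    hU _ _ (hr.trans (hr.trans (hr.symm (hf N)) h) (hf N'))
  have hval : ∀ t : I, ∀ hN, Quot.lift f hwd (Quot.mk _ ⟨_, hN⟩) = t := fun t hN =>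
    hU _ _ (hr.trans (hr.symm (hf ⟨_, hN⟩)) (hr.refl (Nm t)))
  refine ⟨Quot.lift f hwd, ⟨?_, fun t => ⟨Quot.mk r (Nm t), hval t (Nm t).2⟩⟩,
    fun a b c h hN => hval ⟨(a, b, c), h⟩ hN⟩
  rintro ⟨N⟩ ⟨N'⟩ h
  change f N = f N' at h
  exact Quot.sound (hr.trans (hf N) (h ▸ hr.symm (hf N')))

/-- **The class number as a lattice-point count**: for integers `λ₁ > λ₂ > λ₃` the number of `GL₃(ℤ)`-conjugacy
classes of integer matrices with `χ = (t − λ₁)(t − λ₂)(t − λ₃)` equals the number of triples `(a, b, c) ∈ ℤ³` with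
(N1)–(N7) (a finite set: `0 ≤ a < λ₁−λ₂`, `0 ≤ 2c ≤ λ₂−λ₃`, `0 ≤ 2(b(λ₁−λ₂) + ac) ≤ (λ₁−λ₂)(λ₁−λ₃)`).
[cite: HertlingLarabi2026b, §9.3 Remarks 9.7 (ii)–(iii), chunk p0031] -/
theorem natCard_quot_conj_eq {l₁ l₂ l₃ : ℤ} (h₁₂ : l₂ < l₁) (h₂₃ : l₃ < l₂) :
    Nat.card (Quot fun N N' : {N : Matrix (Fin 3) (Fin 3) ℤ //
          N.charpoly = (X - C l₁) * (X - C l₂) * (X - C l₃)} =>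
        ∃ P : Matrix (Fin 3) (Fin 3) ℤ, IsUnit P.det ∧ P * N.1 = N'.1 * P) =
      Nat.card {t : ℤ × ℤ × ℤ // (0 ≤ t.2.2 ∧ 2 * t.2.2 ≤ l₂ - l₃) ∧
          (0 ≤ t.2.1 * (l₁ - l₂) + t.1 * t.2.2 ∧ 2 * (t.2.1 * (l₁ - l₂) + t.1 * t.2.2) ≤ (l₁ - l₂) * (l₁ - l₃)) ∧ (0 ≤ t.1 ∧ t.1 < l₁ - l₂) ∧
          ((t.2.2 = 0 ∨ t.2.1 * (l₁ - l₂) + t.1 * t.2.2 = 0 ∨ 2 * (t.2.1 * (l₁ - l₂) + t.1 * t.2.2) = (l₁ - l₂) * (l₁ - l₃)) → 2 * t.1 ≤ l₁ - l₂) ∧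
          (2 * t.2.2 = l₂ - l₃ → t.2.1 * (l₁ - l₂) + t.1 * t.2.2 = 0 → (t.1 = 0 ∨ 2 * t.1 = l₁ - l₂)) ∧
          (2 * t.2.2 = l₂ - l₃ → 2 * (t.2.1 * (l₁ - l₂) + t.1 * t.2.2) = (l₁ - l₂) * (l₁ - l₃) → 2 * t.1 < l₁ - l₂) ∧
          (2 * t.2.2 = l₂ - l₃ → 0 < t.2.1 * (l₁ - l₂) + t.1 * t.2.2 → 2 * (t.2.1 * (l₁ - l₂) + t.1 * t.2.2) < (l₁ - l₂) * (l₁ - l₃) →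
            t.1 * (l₁ - l₃) ≤ 2 * (t.2.1 * (l₁ - l₂) + t.1 * t.2.2))} := by
  obtain ⟨F, hF, -⟩ := exists_bijective_quot_conj h₁₂ h₂₃
  exact Nat.card_eq_of_bijective F hF

/-- (N1)–(N7) ARE the printed case list (9.17) in the coordinates `δ₁ = a/(λ₁−λ₂)`, `δ₂ = c/(λ₂−λ₃)`,
`δ₃ = B/((λ₁−λ₂)(λ₁−λ₃))`, `B = b(λ₁−λ₂) + ac`, with exactly two corrections: `δ₁ ∈ [0, 1)` (not `[0, 1]`) in the
interior case, and `δ₁ ∈ {0, ½}` (not `[0, ½]`) in the sub-case `(δ₂, δ₃) = (½, 0)`: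
«`δ₂, δ₃ ∈ [0, ½]`, `δ₁ ∈ [0,1]` if `(δ₂, δ₃) ∈ (0, ½) × (0, ½)`, `δ₁ ∈ [0, ½]` if
`(δ₂, δ₃) ∈ (0, ½) × {0, ½} ∪ {0} × (0, ½) ∪ {(0,0), (0,½), (½,0)}`, `δ₁ ∈ [0, 2δ₃]` if `(δ₂, δ₃) ∈ {½} × (0, ½)`,
`δ₁ ∈ [0, ½)` if `(δ₂, δ₃) = (½, ½)`». [cite: HertlingLarabi2026b, §9.3 Lemma 9.6 (a) (9.17), chunk p0030] -/
theorem normalForm_iff_cases {l₁ l₂ l₃ : ℤ} (h₁₂ : l₂ < l₁) (h₂₃ : l₃ < l₂) (a b c : ℤ) :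
    ((0 ≤ c ∧ 2 * c ≤ l₂ - l₃) ∧
          (0 ≤ b * (l₁ - l₂) + a * c ∧ 2 * (b * (l₁ - l₂) + a * c) ≤ (l₁ - l₂) * (l₁ - l₃)) ∧ (0 ≤ a ∧ a < l₁ - l₂) ∧
          ((c = 0 ∨ b * (l₁ - l₂) + a * c = 0 ∨ 2 * (b * (l₁ - l₂) + a * c) = (l₁ - l₂) * (l₁ - l₃)) → 2 * a ≤ l₁ - l₂) ∧
          (2 * c = l₂ - l₃ → b * (l₁ - l₂) + a * c = 0 → (a = 0 ∨ 2 * a = l₁ - l₂)) ∧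
          (2 * c = l₂ - l₃ → 2 * (b * (l₁ - l₂) + a * c) = (l₁ - l₂) * (l₁ - l₃) → 2 * a < l₁ - l₂) ∧
          (2 * c = l₂ - l₃ → 0 < b * (l₁ - l₂) + a * c → 2 * (b * (l₁ - l₂) + a * c) < (l₁ - l₂) * (l₁ - l₃) →
            a * (l₁ - l₃) ≤ 2 * (b * (l₁ - l₂) + a * c))) ↔
      ((0 ≤ 2 * c ∧ 2 * c ≤ l₂ - l₃) ∧
        (0 ≤ 2 * (b * (l₁ - l₂) + a * c) ∧ 2 * (b * (l₁ - l₂) + a * c) ≤ (l₁ - l₂) * (l₁ - l₃)) ∧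
        -- `(δ₂, δ₃) ∈ (0, ½) × (0, ½)`: `δ₁ ∈ [0, 1)` (printed: `[0, 1]`)
        ((0 < 2 * c ∧ 2 * c < l₂ - l₃ ∧ 0 < 2 * (b * (l₁ - l₂) + a * c) ∧
            2 * (b * (l₁ - l₂) + a * c) < (l₁ - l₂) * (l₁ - l₃)) → (0 ≤ a ∧ a < l₁ - l₂)) ∧
        -- `(δ₂, δ₃) ∈ (0, ½) × {0, ½} ∪ {0} × [0, ½]`: `δ₁ ∈ [0, ½]`
        (((0 < 2 * c ∧ 2 * c < l₂ - l₃ ∧ (b * (l₁ - l₂) + a * c = 0 ∨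
              2 * (b * (l₁ - l₂) + a * c) = (l₁ - l₂) * (l₁ - l₃))) ∨ c = 0) → (0 ≤ 2 * a ∧ 2 * a ≤ l₁ - l₂)) ∧
        -- `(δ₂, δ₃) = (½, 0)`: `δ₁ ∈ {0, ½}` (printed: `[0, ½]`)
        ((2 * c = l₂ - l₃ ∧ b * (l₁ - l₂) + a * c = 0) → (a = 0 ∨ 2 * a = l₁ - l₂)) ∧
        -- `(δ₂, δ₃) ∈ {½} × (0, ½)`: `δ₁ ∈ [0, 2δ₃]`
        ((2 * c = l₂ - l₃ ∧ 0 < 2 * (b * (l₁ - l₂) + a * c) ∧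
            2 * (b * (l₁ - l₂) + a * c) < (l₁ - l₂) * (l₁ - l₃)) →
          (0 ≤ a * (l₁ - l₃) ∧ a * (l₁ - l₃) ≤ 2 * (b * (l₁ - l₂) + a * c))) ∧
        -- `(δ₂, δ₃) = (½, ½)`: `δ₁ ∈ [0, ½)`
        ((2 * c = l₂ - l₃ ∧ 2 * (b * (l₁ - l₂) + a * c) = (l₁ - l₂) * (l₁ - l₃)) → (0 ≤ 2 * a ∧ 2 * a < l₁ - l₂))) := by
  have hd₃ : 0 < l₁ - l₃ := by omega
  have hM : 0 < (l₁ - l₂) * (l₁ - l₃) := mul_pos (by omega) hd₃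
  have i₁ : 0 ≤ a → 0 ≤ a * (l₁ - l₃) := fun h => mul_nonneg h hd₃.le
  have i₂ : a < 0 → a * (l₁ - l₃) < 0 := fun h => mul_neg_of_neg_of_pos h hd₃
  have i₃ : a < l₁ - l₂ → a * (l₁ - l₃) < (l₁ - l₂) * (l₁ - l₃) := fun h => mul_lt_mul_of_pos_right h hd₃
  have i₄ : l₁ - l₂ ≤ a → (l₁ - l₂) * (l₁ - l₃) ≤ a * (l₁ - l₃) := fun h => mul_le_mul_of_nonneg_right h hd₃.le
  constructor
  · rintro ⟨hc, hB, ha, h4, h5, h6, h7⟩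
    exact ⟨by omega, by omega, fun _ => ha, fun _ => by omega, fun h => h5 h.1 h.2, fun h => by omega,
      fun h => by omega⟩
  · rintro ⟨hc, hB, hint, hbd, h50, hmid, htop⟩
    exact ⟨by omega, by omega, by omega, fun h => by omega, fun h h' => h50 ⟨h, h'⟩, fun h h' => by omega,
      fun h h' h'' => by omega⟩

/-! ## §6 Example: the ten classes for the eigenvalues `2, 0, −2` (HL §9.4), recounted from the normal form -/

/-- For `(λ₁, λ₂, λ₃) = (2, 0, −2)` the normal forms are the ten triples `(a, b, c) ∈ {0,1} × ℤ × {0,1}` listed below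
(«One finds ten lattices» — HL §9.4 with Remark 9.7 (iii), Table 4.4 column 5). [cite: HertlingLarabi2026b, §9.4 (chunks p0031–p0032) and Rem. 9.7 (iii) (chunk p0031)] -/
theorem normalForm_two_zero_negTwo_iff (t : ℤ × ℤ × ℤ) :
    ((0 ≤ t.2.2 ∧ 2 * t.2.2 ≤ 0 - -2) ∧
          (0 ≤ t.2.1 * (2 - 0) + t.1 * t.2.2 ∧ 2 * (t.2.1 * (2 - 0) + t.1 * t.2.2) ≤ (2 - 0) * (2 - -2)) ∧ (0 ≤ t.1 ∧ t.1 < 2 - 0) ∧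
          ((t.2.2 = 0 ∨ t.2.1 * (2 - 0) + t.1 * t.2.2 = 0 ∨ 2 * (t.2.1 * (2 - 0) + t.1 * t.2.2) = (2 - 0) * (2 - -2)) → 2 * t.1 ≤ 2 - 0) ∧
          (2 * t.2.2 = 0 - -2 → t.2.1 * (2 - 0) + t.1 * t.2.2 = 0 → (t.1 = 0 ∨ 2 * t.1 = 2 - 0)) ∧
          (2 * t.2.2 = 0 - -2 → 2 * (t.2.1 * (2 - 0) + t.1 * t.2.2) = (2 - 0) * (2 - -2) → 2 * t.1 < 2 - 0) ∧
          (2 * t.2.2 = 0 - -2 → 0 < t.2.1 * (2 - 0) + t.1 * t.2.2 → 2 * (t.2.1 * (2 - 0) + t.1 * t.2.2) < (2 - 0) * (2 - -2) →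
            t.1 * (2 - -2) ≤ 2 * (t.2.1 * (2 - 0) + t.1 * t.2.2))) ↔
      t ∈ ({(0, 0, 0), (0, 1, 0), (0, 2, 0), (0, 0, 1), (0, 1, 1), (0, 2, 1), (1, 0, 0), (1, 1, 0), (1, 2, 0),
        (1, 1, 1)} : Finset (ℤ × ℤ × ℤ)) := by
  obtain ⟨a, b, c⟩ := t
  simp only [Finset.mem_insert, Finset.mem_singleton, Prod.mk.injEq]
  constructor
  · rintro ⟨⟨hc0, hc2⟩, ⟨hB0, hB2⟩, ⟨ha0, ha1⟩, h4, h5, h6, h7⟩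
    have ha1' : a < 2 := by omega
    have hc1 : c ≤ 1 := by omega
    interval_cases a <;> interval_cases c <;>
    · have hb0 : 0 ≤ b := by omega
      have hb2 : b ≤ 2 := by omega
      interval_cases b <;> omega
  · rintro (⟨rfl, rfl, rfl⟩ | ⟨rfl, rfl, rfl⟩ | ⟨rfl, rfl, rfl⟩ | ⟨rfl, rfl, rfl⟩ | ⟨rfl, rfl, rfl⟩ |
      ⟨rfl, rfl, rfl⟩ | ⟨rfl, rfl, rfl⟩ | ⟨rfl, rfl, rfl⟩ | ⟨rfl, rfl, rfl⟩ | ⟨rfl, rfl, rfl⟩) <;> decide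

/-- **`#{normal forms for (2, 0, −2)} = 10`** — with `natCard_quot_conj_eq` this re-derives HL §9.4's count («The ten
matrices `M` in column 4 and the ten matrices `M` in column 5 are different representatives of the ten conjugacy
classes of integer `3×3` matrices with eigenvalues `2, 0, −2`») from the normal form, independently of (and agreeing
with) the tree's certificate-based `GL3ZClassesTwoZeroMinusTwo.natCard_quot_conj_eq_ten` — a consistency check of the
corrected (9.17) (not restated here). [cite: HertlingLarabi2026b, §9.4, chunk p0032] -/
theorem natCard_normalForms_two_zero_negTwo :
    Nat.card {t : ℤ × ℤ × ℤ // (0 ≤ t.2.2 ∧ 2 * t.2.2 ≤ 0 - -2) ∧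
          (0 ≤ t.2.1 * (2 - 0) + t.1 * t.2.2 ∧ 2 * (t.2.1 * (2 - 0) + t.1 * t.2.2) ≤ (2 - 0) * (2 - -2)) ∧ (0 ≤ t.1 ∧ t.1 < 2 - 0) ∧
          ((t.2.2 = 0 ∨ t.2.1 * (2 - 0) + t.1 * t.2.2 = 0 ∨ 2 * (t.2.1 * (2 - 0) + t.1 * t.2.2) = (2 - 0) * (2 - -2)) → 2 * t.1 ≤ 2 - 0) ∧
          (2 * t.2.2 = 0 - -2 → t.2.1 * (2 - 0) + t.1 * t.2.2 = 0 → (t.1 = 0 ∨ 2 * t.1 = 2 - 0)) ∧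
          (2 * t.2.2 = 0 - -2 → 2 * (t.2.1 * (2 - 0) + t.1 * t.2.2) = (2 - 0) * (2 - -2) → 2 * t.1 < 2 - 0) ∧
          (2 * t.2.2 = 0 - -2 → 0 < t.2.1 * (2 - 0) + t.1 * t.2.2 → 2 * (t.2.1 * (2 - 0) + t.1 * t.2.2) < (2 - 0) * (2 - -2) →
            t.1 * (2 - -2) ≤ 2 * (t.2.1 * (2 - 0) + t.1 * t.2.2))} = 10 := by
  rw [Nat.card_congr (Equiv.subtypeEquivRight normalForm_two_zero_negTwo_iff), Nat.card_eq_fintype_card,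
    Fintype.card_coe]
  rfl

/-! ## §7 The correction of the printed (9.17): two printed normal forms in one `ε`-class -/

/-- **LITERATURE CORRECTION (the sub-case `(δ₂, δ₃) = (½, 0)` of (9.17))**: for `(λ₁, λ₂, λ₃) = (9, 6, 0)` the
matrices `T₁ = (9 1 −1; 0 6 3; 0 0 0)` and `T₂ = (9 1 2; 0 6 3; 0 0 0)` have HL-coordinates
`(δ₁, δ₂, δ₃) = (⅓, ½, 0)` and `(⅓, ½, ⅓)` (`δ₁ = a/3`, `δ₂ = c/6`, `δ₃ = (3b + ac)/27`); BOTH satisfy the printed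
(9.17) — `T₁` by the clause «`δ₁ ∈ [0, ½]` if `(δ₂, δ₃) ∈ {(0,0), (0,½), (½,0)}`», `T₂` by the clause «`δ₁ ∈ [0, 2δ₃]` if
`(δ₂, δ₃) ∈ {½} × (0, ½)`» — yet they are `GL₃(ℤ)`-conjugate (by the move `ρ`: `P = (1 0 0; 0 1 1; 0 0 −1)`), i.e. the
two full lattices are `ε`-equivalent (Theorem 6.3 / Remarks 9.7 (iii)); so the uniqueness in Lemma 9.6 (a) fails as
printed, and (N5) (`δ₁ ∈ {0, ½}` when `(δ₂, δ₃) = (½, 0)`) is the necessary repair; `T₂` is the normal form, `T₁` is not.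
[cite: HertlingLarabi2026b, §9.3 Lemma 9.6 (a) (9.17), chunk p0030] -/
theorem printed_normalForm_not_unique :
    (∃ P : Matrix (Fin 3) (Fin 3) ℤ, IsUnit P.det ∧
        P * !![9, 1, -1; 0, 6, 3; 0, 0, 0] = !![9, 1, 2; 0, 6, 3; 0, 0, 0] * P) ∧
      (!![9, 1, -1; 0, 6, 3; 0, 0, 0] : Matrix (Fin 3) (Fin 3) ℤ) ≠ !![9, 1, 2; 0, 6, 3; 0, 0, 0] ∧
      -- `T₁ = T(1, −1, 3)`: `(δ₂, δ₃) = (½, 0)` (`2c = λ₂ − λ₃`, `B = 0`) and `δ₁ = ⅓ ∈ [0, ½]` (`0 ≤ 2a ≤ λ₁ − λ₂`) …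
      (2 * (3 : ℤ) = 6 - 0 ∧ (-1) * (9 - 6) + 1 * 3 = (0 : ℤ) ∧ 0 ≤ 2 * (1 : ℤ) ∧ 2 * (1 : ℤ) ≤ 9 - 6) ∧
      -- … but violates (N5); `T₂ = T(1, 2, 3)` is a normal form
      ¬ ((0 ≤ 3 ∧ 2 * 3 ≤ 6 - 0) ∧
          (0 ≤ (-1) * (9 - 6) + 1 * 3 ∧ 2 * ((-1) * (9 - 6) + 1 * 3) ≤ (9 - 6) * (9 - 0)) ∧ (0 ≤ 1 ∧ 1 < 9 - 6) ∧
          ((3 = 0 ∨ (-1) * (9 - 6) + 1 * 3 = 0 ∨ 2 * ((-1) * (9 - 6) + 1 * 3) = (9 - 6) * (9 - 0)) → 2 * 1 ≤ 9 - 6) ∧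
          (2 * 3 = 6 - 0 → (-1) * (9 - 6) + 1 * 3 = 0 → (1 = 0 ∨ 2 * 1 = 9 - 6)) ∧
          (2 * 3 = 6 - 0 → 2 * ((-1) * (9 - 6) + 1 * 3) = (9 - 6) * (9 - 0) → 2 * 1 < 9 - 6) ∧
          (2 * 3 = 6 - 0 → 0 < (-1) * (9 - 6) + 1 * 3 → 2 * ((-1) * (9 - 6) + 1 * 3) < (9 - 6) * (9 - 0) →
            1 * (9 - 0) ≤ 2 * ((-1) * (9 - 6) + 1 * 3))) ∧
      ((0 ≤ 3 ∧ 2 * 3 ≤ 6 - 0) ∧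
          (0 ≤ 2 * (9 - 6) + 1 * 3 ∧ 2 * (2 * (9 - 6) + 1 * 3) ≤ (9 - 6) * (9 - 0)) ∧ (0 ≤ 1 ∧ 1 < 9 - 6) ∧
          ((3 = 0 ∨ 2 * (9 - 6) + 1 * 3 = 0 ∨ 2 * (2 * (9 - 6) + 1 * 3) = (9 - 6) * (9 - 0)) → 2 * 1 ≤ 9 - 6) ∧
          (2 * 3 = 6 - 0 → 2 * (9 - 6) + 1 * 3 = 0 → (1 = 0 ∨ 2 * 1 = 9 - 6)) ∧
          (2 * 3 = 6 - 0 → 2 * (2 * (9 - 6) + 1 * 3) = (9 - 6) * (9 - 0) → 2 * 1 < 9 - 6) ∧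
          (2 * 3 = 6 - 0 → 0 < 2 * (9 - 6) + 1 * 3 → 2 * (2 * (9 - 6) + 1 * 3) < (9 - 6) * (9 - 0) →
            1 * (9 - 0) ≤ 2 * (2 * (9 - 6) + 1 * 3))) := by
  refine ⟨?_, fun h => ?_, by norm_num, by norm_num, by norm_num⟩
  · have h := rho_conj 9 6 0 1 (-1) 3 (by norm_num)
    rwa [show (1 : ℤ) - -1 = 2 by norm_num] at h
  · have h02 := congr_fun (congr_fun h 0) 2
    simp at h02

/-- The interior case of (9.17) must be read with `δ₁ ∈ [0, 1)`: for `(λ₁, λ₂, λ₃) = (4, 3, 0)` the matrices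
`(4 1 0; 0 3 1; 0 0 0)` (`(δ₁, δ₂, δ₃) = (1, ⅓, ¼)`) and `(4 0 1; 0 3 1; 0 0 0)` (`(δ₁, δ₂, δ₃) = (0, ⅓, ¼)`) are
conjugate (`δ₁ ↦ δ₁ − 1`, the move `1 + ke₁₂` of (9.1)/(9.2) — evidently the intended reading).
[cite: HertlingLarabi2026b, §9.1 (9.2) («`δ_{ij} ∈ (−½, ½]`») and §9.3 (9.17), chunks p0027, p0030] -/
theorem printed_normalForm_not_unique' :
    (∃ P : Matrix (Fin 3) (Fin 3) ℤ, IsUnit P.det ∧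
        P * !![4, 1, 0; 0, 3, 1; 0, 0, 0] = !![4, 0, 1; 0, 3, 1; 0, 0, 0] * P) ∧
      (!![4, 1, 0; 0, 3, 1; 0, 0, 0] : Matrix (Fin 3) (Fin 3) ℤ) ≠ !![4, 0, 1; 0, 3, 1; 0, 0, 0] := by
  refine ⟨?_, fun h => ?_⟩
  · have h := move₁ 4 3 0 1 0 1 1
    rwa [show (1 : ℤ) - 1 * (4 - 3) = 0 by norm_num, show (0 : ℤ) + 1 * 1 = 1 by norm_num] at h
  · have h01 := congr_fun (congr_fun h 0) 1
    simp at h01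

/-! ## §8 The `δ`-dictionary: the normal form in Hertling–Larabi's coordinates `δ₁, δ₂, δ₃ ∈ ℚ` -/

/-- **Remarks 9.7 (iii), computed**: for the `ℤ`-basis `eD`, `D = (1 δ₁ δ₃; 0 1 δ₂; 0 0 1)` (9.16), the matrix `M`
with `(λ₁e₁ + λ₂e₂ + λ₃e₃)·eD = eD·M`, i.e. `diag(λ₁, λ₂, λ₃)·D = D·M`, is
`M = (λ₁ δ₁(λ₁−λ₂) δ₃(λ₁−λ₃)−δ₁δ₂(λ₂−λ₃); 0 λ₂ δ₂(λ₂−λ₃); 0 0 λ₃)` — so `a = δ₁(λ₁−λ₂)`, `c = δ₂(λ₂−λ₃)` and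
(`bInv_basis_eq`) `B = b(λ₁−λ₂) + ac = δ₃(λ₁−λ₂)(λ₁−λ₃)`. [cite: HertlingLarabi2026b, §9.3 Remarks 9.7 (iii) with (9.16), chunks p0030–p0031] -/
theorem diag_mul_basis_eq (l₁ l₂ l₃ δ₁ δ₂ δ₃ : ℚ) :
    !![l₁, 0, 0; 0, l₂, 0; 0, 0, l₃] * !![1, δ₁, δ₃; 0, 1, δ₂; 0, 0, 1] =
      !![1, δ₁, δ₃; 0, 1, δ₂; 0, 0, 1] *
        !![l₁, δ₁ * (l₁ - l₂), δ₃ * (l₁ - l₃) - δ₁ * δ₂ * (l₂ - l₃); 0, l₂, δ₂ * (l₂ - l₃); 0, 0, l₃] := by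
  ext i j
  fin_cases i <;> fin_cases j <;> simp [Matrix.mul_apply, Fin.sum_univ_three] <;> ring

/-- The invariant `B = b(λ₁−λ₂) + ac` of the matrix of `diag_mul_basis_eq` is `δ₃(λ₁−λ₂)(λ₁−λ₃)` (`δ₃ = B/((λ₁−λ₂)(λ₁−λ₃))`).
[cite: HertlingLarabi2026b, §9.3 (9.16), chunk p0030] -/
theorem bInv_basis_eq (l₁ l₂ l₃ δ₁ δ₂ δ₃ : ℚ) :
    (δ₃ * (l₁ - l₃) - δ₁ * δ₂ * (l₂ - l₃)) * (l₁ - l₂) + δ₁ * (l₁ - l₂) * (δ₂ * (l₂ - l₃)) =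
      δ₃ * ((l₁ - l₂) * (l₁ - l₃)) := by
  ring

/-- **(N1)–(N7) ⟺ the corrected (9.17), in the coordinates `δ₁, δ₂, δ₃`.**  For integers `λ₁ > λ₂ > λ₃`, `a, b, c`
and rationals `δᵢ` with `a = δ₁(λ₁−λ₂)`, `c = δ₂(λ₂−λ₃)`, `b(λ₁−λ₂) + ac = δ₃(λ₁−λ₂)(λ₁−λ₃)` (the dictionary of
`diag_mul_basis_eq`), the normal form conditions (N1)–(N7) say exactly: «`δ₂, δ₃ ∈ [0, ½]`», `δ₁ ∈ [0, 1)` [printed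
`[0, 1]`], `δ₁ ≤ ½` if `δ₂ = 0` or `δ₃ ∈ {0, ½}` [printed: `δ₁ ∈ [0, ½]` if
`(δ₂, δ₃) ∈ (0, ½) × {0, ½} ∪ {0} × (0, ½) ∪ {(0,0), (0,½), (½,0)}`, and for `(½, ½)`], `δ₁ ∈ {0, ½}` if
`(δ₂, δ₃) = (½, 0)` [the CORRECTION; printed `[0, ½]`], «`δ₁ ∈ [0, ½)` if `(δ₂, δ₃) = (½, ½)`», «`δ₁ ∈ [0, 2δ₃]` if
`(δ₂, δ₃) ∈ {½} × (0, ½)`». [cite: HertlingLarabi2026b, §9.3 Lemma 9.6 (a) (9.17), chunk p0030] -/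
theorem normalForm_iff_delta {l₁ l₂ l₃ a b c : ℤ} (h₁₂ : l₂ < l₁) (h₂₃ : l₃ < l₂) {δ₁ δ₂ δ₃ : ℚ}
    (ha : (a : ℚ) = δ₁ * (l₁ - l₂)) (hc : (c : ℚ) = δ₂ * (l₂ - l₃))
    (hB : ((b * (l₁ - l₂) + a * c : ℤ) : ℚ) = δ₃ * ((l₁ - l₂) * (l₁ - l₃))) :
    ((0 ≤ c ∧ 2 * c ≤ l₂ - l₃) ∧
        (0 ≤ b * (l₁ - l₂) + a * c ∧ 2 * (b * (l₁ - l₂) + a * c) ≤ (l₁ - l₂) * (l₁ - l₃)) ∧ (0 ≤ a ∧ a < l₁ - l₂) ∧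
        ((c = 0 ∨ b * (l₁ - l₂) + a * c = 0 ∨ 2 * (b * (l₁ - l₂) + a * c) = (l₁ - l₂) * (l₁ - l₃)) → 2 * a ≤ l₁ - l₂) ∧
        (2 * c = l₂ - l₃ → b * (l₁ - l₂) + a * c = 0 → (a = 0 ∨ 2 * a = l₁ - l₂)) ∧
        (2 * c = l₂ - l₃ → 2 * (b * (l₁ - l₂) + a * c) = (l₁ - l₂) * (l₁ - l₃) → 2 * a < l₁ - l₂) ∧
        (2 * c = l₂ - l₃ → 0 < b * (l₁ - l₂) + a * c → 2 * (b * (l₁ - l₂) + a * c) < (l₁ - l₂) * (l₁ - l₃) →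
          a * (l₁ - l₃) ≤ 2 * (b * (l₁ - l₂) + a * c))) ↔
      ((0 ≤ δ₂ ∧ δ₂ ≤ 1 / 2) ∧ (0 ≤ δ₃ ∧ δ₃ ≤ 1 / 2) ∧ (0 ≤ δ₁ ∧ δ₁ < 1) ∧
        ((δ₂ = 0 ∨ δ₃ = 0 ∨ δ₃ = 1 / 2) → δ₁ ≤ 1 / 2) ∧
        (δ₂ = 1 / 2 → δ₃ = 0 → (δ₁ = 0 ∨ δ₁ = 1 / 2)) ∧
        (δ₂ = 1 / 2 → δ₃ = 1 / 2 → δ₁ < 1 / 2) ∧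
        (δ₂ = 1 / 2 → 0 < δ₃ → δ₃ < 1 / 2 → δ₁ ≤ 2 * δ₃)) := by
  have hd₁ : (0 : ℚ) < l₁ - l₂ := by exact_mod_cast sub_pos.2 h₁₂
  have hd₂ : (0 : ℚ) < l₂ - l₃ := by exact_mod_cast sub_pos.2 h₂₃
  have hd₃ : (0 : ℚ) < l₁ - l₃ := by linarith
  have hM : (0 : ℚ) < (l₁ - l₂) * (l₁ - l₃) := mul_pos hd₁ hd₃
  -- integer clauses as rational clauses
  have q1 : 0 ≤ c ↔ (0 : ℚ) ≤ c := by norm_cast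
  have q2 : 2 * c ≤ l₂ - l₃ ↔ 2 * (c : ℚ) ≤ (l₂ : ℚ) - l₃ := by norm_cast
  have q3 : 2 * c = l₂ - l₃ ↔ 2 * (c : ℚ) = (l₂ : ℚ) - l₃ := by norm_cast
  have q4 : c = 0 ↔ (c : ℚ) = 0 := by norm_cast
  have q5 : 0 ≤ b * (l₁ - l₂) + a * c ↔ (0 : ℚ) ≤ ((b * (l₁ - l₂) + a * c : ℤ) : ℚ) := by norm_cast
  have q6 : 2 * (b * (l₁ - l₂) + a * c) ≤ (l₁ - l₂) * (l₁ - l₃) ↔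
      2 * ((b * (l₁ - l₂) + a * c : ℤ) : ℚ) ≤ ((l₁ : ℚ) - l₂) * (l₁ - l₃) := by norm_cast
  have q7 : 2 * (b * (l₁ - l₂) + a * c) = (l₁ - l₂) * (l₁ - l₃) ↔
      2 * ((b * (l₁ - l₂) + a * c : ℤ) : ℚ) = ((l₁ : ℚ) - l₂) * (l₁ - l₃) := by norm_cast
  have q8 : b * (l₁ - l₂) + a * c = 0 ↔ ((b * (l₁ - l₂) + a * c : ℤ) : ℚ) = 0 := by norm_cast
  have q9 : 0 < b * (l₁ - l₂) + a * c ↔ (0 : ℚ) < ((b * (l₁ - l₂) + a * c : ℤ) : ℚ) := by norm_cast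
  have q10 : 2 * (b * (l₁ - l₂) + a * c) < (l₁ - l₂) * (l₁ - l₃) ↔
      2 * ((b * (l₁ - l₂) + a * c : ℤ) : ℚ) < ((l₁ : ℚ) - l₂) * (l₁ - l₃) := by norm_cast
  have q11 : 0 ≤ a ↔ (0 : ℚ) ≤ a := by norm_cast
  have q12 : a < l₁ - l₂ ↔ (a : ℚ) < (l₁ : ℚ) - l₂ := by norm_cast
  have q13 : 2 * a ≤ l₁ - l₂ ↔ 2 * (a : ℚ) ≤ (l₁ : ℚ) - l₂ := by norm_cast
  have q14 : a = 0 ↔ (a : ℚ) = 0 := by norm_cast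
  have q15 : 2 * a = l₁ - l₂ ↔ 2 * (a : ℚ) = (l₁ : ℚ) - l₂ := by norm_cast
  have q16 : 2 * a < l₁ - l₂ ↔ 2 * (a : ℚ) < (l₁ : ℚ) - l₂ := by norm_cast
  have q17 : a * (l₁ - l₃) ≤ 2 * (b * (l₁ - l₂) + a * c) ↔
      (a : ℚ) * ((l₁ : ℚ) - l₃) ≤ 2 * ((b * (l₁ - l₂) + a * c : ℤ) : ℚ) := by norm_cast
  rw [q1, q2, q3, q4, q5, q6, q7, q8, q9, q10, q11, q12, q13, q14, q15, q16, q17, ha, hc, hB]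
  -- rational clauses as `δ`-clauses
  have E1 : (0 : ℚ) ≤ δ₂ * (l₂ - l₃) ↔ 0 ≤ δ₂ := by constructor <;> intro h <;> nlinarith
  have E2 : 2 * (δ₂ * ((l₂ : ℚ) - l₃)) ≤ (l₂ : ℚ) - l₃ ↔ δ₂ ≤ 1 / 2 := by constructor <;> intro h <;> nlinarith
  have E3 : 2 * (δ₂ * ((l₂ : ℚ) - l₃)) = (l₂ : ℚ) - l₃ ↔ δ₂ = 1 / 2 := by
    constructor <;> intro h
    · exact mul_right_cancel₀ hd₂.ne' (by linarith)
    · rw [h]; ring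
  have E4 : δ₂ * ((l₂ : ℚ) - l₃) = 0 ↔ δ₂ = 0 := by simp [hd₂.ne']
  have E5 : (0 : ℚ) ≤ δ₃ * ((l₁ - l₂) * (l₁ - l₃)) ↔ 0 ≤ δ₃ := by constructor <;> intro h <;> nlinarith
  have E6 : 2 * (δ₃ * (((l₁ : ℚ) - l₂) * (l₁ - l₃))) ≤ ((l₁ : ℚ) - l₂) * (l₁ - l₃) ↔ δ₃ ≤ 1 / 2 := by
    constructor <;> intro h <;> nlinarith
  have E7 : 2 * (δ₃ * (((l₁ : ℚ) - l₂) * (l₁ - l₃))) = ((l₁ : ℚ) - l₂) * (l₁ - l₃) ↔ δ₃ = 1 / 2 := by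
    constructor <;> intro h
    · exact mul_right_cancel₀ hM.ne' (by linarith)
    · rw [h]; ring
  have E8 : δ₃ * (((l₁ : ℚ) - l₂) * (l₁ - l₃)) = 0 ↔ δ₃ = 0 := by simp [hM.ne']
  have E9 : (0 : ℚ) < δ₃ * ((l₁ - l₂) * (l₁ - l₃)) ↔ 0 < δ₃ := by constructor <;> intro h <;> nlinarith
  have E10 : 2 * (δ₃ * (((l₁ : ℚ) - l₂) * (l₁ - l₃))) < ((l₁ : ℚ) - l₂) * (l₁ - l₃) ↔ δ₃ < 1 / 2 := by
    constructor <;> intro h <;> nlinarith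
  have E11 : (0 : ℚ) ≤ δ₁ * (l₁ - l₂) ↔ 0 ≤ δ₁ := by constructor <;> intro h <;> nlinarith
  have E12 : δ₁ * ((l₁ : ℚ) - l₂) < (l₁ : ℚ) - l₂ ↔ δ₁ < 1 := by constructor <;> intro h <;> nlinarith
  have E13 : 2 * (δ₁ * ((l₁ : ℚ) - l₂)) ≤ (l₁ : ℚ) - l₂ ↔ δ₁ ≤ 1 / 2 := by constructor <;> intro h <;> nlinarith
  have E14 : δ₁ * ((l₁ : ℚ) - l₂) = 0 ↔ δ₁ = 0 := by simp [hd₁.ne']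
  have E15 : 2 * (δ₁ * ((l₁ : ℚ) - l₂)) = (l₁ : ℚ) - l₂ ↔ δ₁ = 1 / 2 := by
    constructor <;> intro h
    · exact mul_right_cancel₀ hd₁.ne' (by linarith)
    · rw [h]; ring
  have E16 : 2 * (δ₁ * ((l₁ : ℚ) - l₂)) < (l₁ : ℚ) - l₂ ↔ δ₁ < 1 / 2 := by constructor <;> intro h <;> nlinarith
  have E17 : δ₁ * ((l₁ : ℚ) - l₂) * ((l₁ : ℚ) - l₃) ≤ 2 * (δ₃ * (((l₁ : ℚ) - l₂) * (l₁ - l₃))) ↔ δ₁ ≤ 2 * δ₃ := by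
    rw [mul_assoc, show 2 * (δ₃ * (((l₁ : ℚ) - l₂) * (l₁ - l₃))) = (2 * δ₃) * (((l₁ : ℚ) - l₂) * (l₁ - l₃)) by ring]
    exact mul_le_mul_iff_of_pos_right hM
  rw [E1, E2, E3, E4, E5, E6, E7, E8, E9, E10, E11, E12, E13, E14, E15, E16, E17]

end Literature.LinearAlgebra.Matrix.GL3ZDistinctIntegerEigenvalues
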